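import Literature.Probability.RandomPlanarGeometry.HexSAWBrickWallStripFugacityTwoWallSwitch
import Literature.Probability.RandomPlanarGeometry.HexSAWBrickWallStripFugacityWidthOneSwitch
import Literature.Probability.RandomPlanarGeometry.HexSAWBrickWallStripFugacityTwoWallUpper
import Mathlib.Analysis.SpecialFunctions.Pow.Real
import Mathlib.Analysis.Complex.ExponentialBounds
import HarnessLib

/-!
# The two-wall tower of honeycomb SAW at high fugacity is ORDERED at the top, uniformly in the width:
# `μ_T(y,y) < μ_1(y,y)` for every `T ≥ 2` (`y ≥ 25`), `μ_T(y,y) < μ_2(y,y)` for every `T ≥ 3` (`y ≥ 400`), from the uniform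
# windows `y < μ_T(y,y)² ≤ y + 4/(√y − 1)` (`T ≥ 2`, `y ≥ 4`) and `μ_T(y,y)² ≤ y + 6/y` (`T ≥ 3`, `y ≥ 25`)

Topic `Literature/Probability/RandomPlanarGeometry` (lane «pcv-sawmu», car «TWO-WALL TOWER ORDER», a-p5 gen 15; continues
`HexSAWBrickWallStripFugacityTwoSided.lean` (`HexBW.stripZ₂ T n y z = C_{T,n}(y,z)`, `HexBW.stripMuY₂ T y z = μ_T(y,z)`,
`tendsto_stripZ₂_rpow`), `HexSAWBrickWallStripFugacityWidthOneSwitch.lean` (`mul_pow_le_stripMuY₂_one_self_pow : m·y^m ≤ μ_1(y,y)^{2m+1}`),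
`HexSAWBrickWallStripFugacityTwoWallSwitch.lean` (`mul_pow_le_stripMuY₂_self_pow : m·y^m ≤ μ_T(y,y)^{2m+2T−1}`, `sqrt_lt_stripMuY₂_self :
√y < μ_T(y,y)`) and `HexSAWBrickWallStripFugacityTwoWallUpper.lean` (`μ_T(y,y) ≤ √y·μ(S_T)`, `tendsto_const_rpow_one_div_nat₀`)).

Sources.  N. R. Beaton, M. Bousquet-Mélou, J. de Gier, H. Duminil-Copin, A. J. Guttmann, *The critical fugacity for surface adsorption of
self-avoiding walks on the honeycomb lattice is `1 + √2`*, CMP 326 (2014) = arXiv:1109.0358v5, §3.2 p. 10 (the strip `S_T`, the two-fugacity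
partition function `C_{T,k}(y,z) = Σ y^{bc(ω)} z^{tc(ω)}`, Proposition 6: the growth rate `μ_T(y,z)`), §3.1 Proposition 5 (p. 9 l. 16:
`μ(y) ≥ √y`, walks sticking to the surface; p. 10 ll. 2–3: "`μ(y) ∼ √y`").  I. G. Enting, I. Jensen, LNP 775 (2009), §7.4.2, Fig. 7.10 (the
brick-wall form of the honeycomb lattice: vertical bonds `{(x,y),(x,y+1)}` with `x + y` even).  N. Madras, G. Slade, *The Self-Avoiding Walk*
(1993), §1.2 (elementary counting), §8.2 (8.2.1)–(8.2.3) (walks in strips, Fekete).  Context (not used in the proofs, sources not held — labels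
PROVISIONAL on them): E. J. Janse van Rensburg, E. Orlandini, A. L. Owczarek, A. Rechnitzer, S. G. Whittington, J. Phys. A 38 (2005) L823
(self-avoiding walks in a slit with two attractive walls: existence of the free energy, the force between the walls); J. Alvarez, E. J. Janse
van Rensburg, C. E. Soteros, S. G. Whittington, J. Phys. A 41 (2008) 185004 (polygons and walks in slits; as summarised in A. J. Guttmann (ed.),
*Polygons, Polyominoes and Polycubes*, LNP 775, §10.3 pp. 250–253: along `a = b` "both attractive and repulsive regimes are seen", and for
single-layer polygons "the result may indeed be true for all `w`, but this has not been proved").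

## What is proved (namespace `Literature.Probability.RandomPlanarGeometry.SAW.HexBW`; `μ_T(y,y) = stripMuY₂ T y y`)

* **`stripMuY₂_self_sq_le_of_two_le`** — `2 ≤ T → 4 ≤ y → μ_T(y,y)² ≤ y + 4/(√y − 1)` (uniformly in `T`; with the tree's
  `sqrt_lt_stripMuY₂_self`: `y < μ_T(y,y)² ≤ y + 4/(√y−1)`, i.e. `μ_T(y,y) = √y + O(1/y)` for every fixed `T ≥ 2`);
* **`stripMuY₂_self_sq_le_of_three_le`** — `3 ≤ T → 25 ≤ y → μ_T(y,y)² ≤ y + 6/y` (uniformly in `T`);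
* ★ **`stripMuY₂_self_lt_one`** — `2 ≤ T → 25 ≤ y → μ_T(y,y) < μ_1(y,y)`; `stripMuY₂_self_le_one` (`T ≥ 1`): **the width-one slit
  maximises the two-wall growth rate among all widths, for every `y ≥ 25`**;
* ★ **`stripMuY₂_self_lt_two`** — `3 ≤ T → 400 ≤ y → μ_T(y,y) < μ_2(y,y)`; `stripMuY₂_self_le_two` (`T ≥ 2`); `stripMuY₂_self_chain`:
  `μ_T(y,y) < μ_2(y,y) < μ_1(y,y)` for every `T ≥ 3`, `y ≥ 400`;
* the engine (sub-namespace `HexBW.WallPot`): `stripMuY₂_self_le_of_potValid` — `μ_T(y,y) ≤ ρ` (`T ≥ 2`) whenever a WALL POTENTIAL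
  (`PotVals`, nine state classes `cls`: wall vertex / wall row / next row toward / next row away / bulk, × arrival type horizontal/vertical)
  satisfies the twelve local inequalities `PotValid T y ρ`; the explicit potentials `potValsA` (all `T ≥ 2`, valid once `ρ ≥ 2` and
  `y + 4y/(ρ²(ρ−1)) ≤ ρ²`) and `potValsB` (`T ≥ 3`, valid once `ρ ≥ 2` and `y + 4y(ρ+2)/(ρ²(ρ³−ρ−2)) ≤ ρ²`); the arithmetic
  `windowA_pow_lt : (y + 4/(√y−1))^{2m+1} < m²·y^{2m}` (`m = ⌊2√y⌋+1`, `y ≥ 25`) and `windowB_pow_lt : (y + 6/y)^{2m+3} < m²·y^{2m}`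
  (`m = ⌊3y√y⌋+1`, `y ≥ 400`).

## Method: a wall potential (sub-harmonic vector) for the non-backtracking relaxation

Every vertex of the brick wall has exactly one vertical bond, pointing up iff `x + y` is even; the weighted vertices of `S_T` are those of
the bottom row whose bond dangles down and those of the top row whose bond dangles up, so a step ARRIVING at a vertex of row `r` with bond
parity `q` collects `wArr T y r q ∈ {1, y}`.  A self-avoiding walk never reverses its last step; relax self-avoidance to exactly this.  For a
positive function `pot` of the state (row, parity, arrival type) the sum `potSum N = Σ_ω y^{bc+tc}·pot(state after the last step)` over
`stripPairs T (N+1)` satisfies `potSum (N+1) ≤ ρ · potSum N` as soon as, state by state, the total weighted potential of the (two or three)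
admissible successor states is at most `ρ·pot` (`sum_fibre_le`: the fibre of a prefix injects into the admissible moves `lastCode`, the
reverse move being excluded by `siteAt_add_two_ne`); hence `C_{T,N}(y,y) ≤ const·ρ^N` and `μ_T(y,y) ≤ ρ`.  The two potentials are the
Perron vectors, up to slack, of the relaxed transfer operator near the walls: after a wall vertex the only admissible move is the straight
continuation (this is what makes the leading term exactly `y` per two steps), the first correction comes from the width-two switch blocks of
length `5` (order `y^{-1/2}`, absent for `T ≥ 3`) and from the one-row excursions of length `6` (order `y^{-1}`); the bulk carries a
geometrically small constant potential, which is why the bounds do not depend on `T`.  The comparison with the explicit switch walks of the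
two `…Switch` files (`μ_1(y,y)² ≥ (m·y^m)^{2/(2m+1)} ≈ y + 0.37√y`, `μ_2(y,y)² ≥ (m·y^m)^{2/(2m+3)} ≈ y + 0.37/√y`) is elementary
(`(1+x)^n ≤ e^{nx}`, `e < 3`, `e² < 9`).  Numerically the relaxed operator has `(ρ_T² − y)·√y → 4.06…` at `T = 2` and `(ρ_T² − y)·y → 4.00…`
for `T ≥ 3` (`y = 4096`), so the constants `4/(√y−1)` and `6/y` are those of the relaxation up to the stated slack; the thresholds `25` and
`400` are what this slack affords and are NOT claimed sharp (the exact relaxation already separates `μ_1` from all `μ_T` at `y = 16`).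

## Status in print and label (author's proposal, lane «pcv-sawmu»)

Print (BBdGDCG14 Prop. 6) defines `μ_T(y,z)` and proves monotonicity in the fugacities and the symmetry `μ_T(y,z) = μ_T(z,y)`; the
dependence on the WIDTH at two attractive walls is discussed in the slit literature above through the force `∂κ/∂w` (numerically: attractive
and repulsive regimes; for the directed model exactly), without a rigorous ordering of the widths for undirected walks known to us.  The
statements here — an explicit, `T`-uniform high-fugacity window for `μ_T(y,y)` and the strict order `μ_1 > μ_2 > μ_T` (`T ≥ 3`) at large `y` —
are proposed as NEW-IN-WRITING (modest, S) for the honeycomb lattice, PROVISIONAL on JvROW05 / AJvRSW08 (not held).  NOT claimed: the order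
of `μ_T(y,y)` among `T ≥ 3` (the relaxation cannot see it: from `T = 3` on the first correction is the common one-row excursion term), any
statement for `y < 25`, and any comparison with the half-plane rate `μ(y)` (that is the lane's HOME car «TWO-WALL ATTRACTIVE WIDTH ONE/TWO»,
which needs `HexSAWSurfaceSqrtAsymptotic`).  Frame: brick-wall strips `S_T = ℤ × {0,…,T}` of the honeycomb lattice, translation classes,
printed weights (`bc`, `tc`), as in the whole `HexSAWBrickWallStripFugacity*` family.
-/

noncomputable section

open Filter Topology Finset Literature.Probability.LatticeModels Literature.Probability.Percolation SimpleGraph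

namespace Literature.Probability.RandomPlanarGeometry.SAW.HexBW

namespace WallPot

/-! ### §1 The wall potential (an abstract sub-harmonic vector for the non-backtracking relaxation) -/

/-- The values of the wall potential on the state classes off the wall vertices (`E` = on a wall row, off the wall vertices;
`Lt`/`La` = on a row next to a wall, vertical bond pointing toward / away from that wall; `M` = bulk; `a,c,e,g` after a
horizontal step, `b,d,f,k` after a vertical step). [cite: MadrasSlade1993, §1.2 (elementary counting)] -/
structure PotVals where
  /-- `E`, arrived horizontally -/
  a : ℝ
  /-- `E`, arrived vertically -/
  b : ℝ
  /-- `Lt`, arrived horizontally -/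
  c : ℝ
  /-- `Lt`, arrived vertically -/
  d : ℝ
  /-- `La`, arrived horizontally -/
  e : ℝ
  /-- `La`, arrived vertically -/
  f : ℝ
  /-- bulk, arrived horizontally -/
  g : ℝ
  /-- bulk, arrived vertically -/
  k : ℝ

/-- The state class of a site of `S_T` of row `r` and bond parity `q = (x + r) mod 2` (`q = 0`: the vertical bond goes up):
`0` = wall vertex (`W`), `1` = wall row off the wall vertices (`E`), `2` = next-to-wall row with the bond toward that wall (`Lt`),
`3` = next-to-wall row with the bond away from it (`La`), `4` = bulk. [cite: EntingJensen2009, §7.4.2, Fig. 7.10 (vertical bonds {(x,y),(x,y+1)} with x+y even)] -/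
def cls (T : ℕ) (r q : ℤ) : ℕ :=
  if (r = 0 ∧ q = 1) ∨ (r = (T : ℤ) ∧ q = 0) then 0
  else if r = 0 ∨ r = (T : ℤ) then 1
  else if (r = 1 ∧ q = 1) ∨ (r = (T : ℤ) - 1 ∧ q = 0) then 2
  else if r = 1 ∨ r = (T : ℤ) - 1 then 3
  else 4

/-- The potential by class and arrival type (`v` = arrived by a vertical step). [cite: MadrasSlade1993, §1.2 (elementary counting)] -/
def potOf (P : PotVals) : ℕ → Bool → ℝ
  | 0, false => 1
  | 0, true => 2 * P.a
  | 1, false => P.a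
  | 1, true => P.b
  | 2, false => P.c
  | 2, true => P.d
  | 3, false => P.e
  | 3, true => P.f
  | _, false => P.g
  | _, true => P.k

/-- The wall potential of a state `(r, q, v)` of `S_T`. [cite: MadrasSlade1993, §1.2 (elementary counting)] -/
def pot (T : ℕ) (P : PotVals) (r q : ℤ) (v : Bool) : ℝ := potOf P (cls T r q) v

/-- The arrival weight of a site of `S_T`: `y` on a wall vertex (bottom row with the vertical bond dangling down, `q = 1`;
top row with the bond dangling up, `q = 0`), `1` elsewhere. [cite: BeatonBousquetMelouDeGierDuminilCopinGuttmann2014, §3.2 (arXiv v5 p. 10: bc(ω), tc(ω))] -/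
def wArr (T : ℕ) (y : ℝ) (r q : ℤ) : ℝ := if (r = 0 ∧ q = 1) ∨ (r = (T : ℤ) ∧ q = 0) then y else 1

/-- The row reached along the vertical bond of a site of row `r` and parity `q`. [cite: EntingJensen2009, §7.4.2, Fig. 7.10] -/
def vRow (r q : ℤ) : ℤ := if q = 0 then r + 1 else r - 1

/-- The local inequalities making the wall potential sub-harmonic at rate `ρ` for the non-backtracking walk in `S_T` with
arrival weights `wArr`. [cite: MadrasSlade1993, §1.2 (elementary counting)] -/
structure PotValid (T : ℕ) (y ρ : ℝ) (P : PotVals) : Prop where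
  /-- the fugacity is positive -/
  pos_y : 0 < y
  /-- positivity of the potential -/
  pos_a : 0 < P.a
  /-- positivity of the potential -/
  pos_b : 0 < P.b
  /-- positivity of the potential -/
  pos_c : 0 < P.c
  /-- positivity of the potential -/
  pos_d : 0 < P.d
  /-- positivity of the potential -/
  pos_e : 0 < P.e
  /-- positivity of the potential -/
  pos_f : 0 < P.f
  /-- positivity of the potential -/
  pos_g : 0 < P.g
  /-- positivity of the potential -/
  pos_k : 0 < P.k
  /-- the rate is at least the non-backtracking branching number `2` -/
  two_le : 2 ≤ ρ
  /-- wall vertex, arrived horizontally: the straight continuation only -/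
  hW : P.a ≤ ρ
  /-- wall row off the wall vertices, arrived horizontally: the weighted continuation and the vertical step inward -/
  hEh : y + P.d ≤ ρ * P.a
  /-- wall row off the wall vertices, arrived vertically: two weighted horizontal steps -/
  hEv : 2 * y ≤ ρ * P.b
  /-- next-to-wall row, bond toward the wall, arrived horizontally -/
  hLth : (if T = 2 then P.c else P.e) + P.b ≤ ρ * P.c
  /-- next-to-wall row, bond toward the wall, arrived vertically -/
  hLtv : 2 * (if T = 2 then P.c else P.e) ≤ ρ * P.d
  /-- next-to-wall row, bond away from the wall, arrived horizontally (`T = 3`: the vertical step reaches the other wall's layer) -/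
  hLah_f : P.c + P.f ≤ ρ * P.e
  /-- next-to-wall row, bond away from the wall, arrived horizontally (`T ≥ 4`: the vertical step reaches the bulk) -/
  hLah_k : P.c + P.k ≤ ρ * P.e
  /-- next-to-wall row, bond away from the wall, arrived vertically -/
  hLav : 2 * P.c ≤ ρ * P.f
  /-- bulk, arrived horizontally, vertical step into a next-to-wall row -/
  hMh_f : P.g + P.f ≤ ρ * P.g
  /-- bulk, arrived horizontally, vertical step into the bulk -/
  hMh_k : P.g + P.k ≤ ρ * P.g
  /-- bulk, arrived vertically -/
  hMv : 2 * P.g ≤ ρ * P.k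

variable {T : ℕ} {y ρ : ℝ} {P : PotVals}

/-- The least value of the potential. [cite: MadrasSlade1993, §1.2 (elementary counting)] -/
def potMin (P : PotVals) : ℝ := min 1 (min P.a (min P.b (min P.c (min P.d (min P.e (min P.f (min P.g P.k)))))))

/-- `0 < potMin`. [cite: MadrasSlade1993, §1.2 (elementary counting)] -/
theorem potMin_pos (hV : PotValid T y ρ P) : 0 < potMin P := by
  have := hV.pos_a; have := hV.pos_b; have := hV.pos_c; have := hV.pos_d
  have := hV.pos_e; have := hV.pos_f; have := hV.pos_g; have := hV.pos_k
  unfold potMin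
  positivity

/-- `potMin ≤ potOf`. [cite: MadrasSlade1993, §1.2 (elementary counting)] -/
theorem potMin_le_potOf (hV : PotValid T y ρ P) (n : ℕ) (v : Bool) : potMin P ≤ potOf P n v := by
  have pa := hV.pos_a
  have h1 : potMin P ≤ 1 := min_le_left _ _
  have ha : potMin P ≤ P.a := (min_le_right _ _).trans (min_le_left _ _)
  have hb : potMin P ≤ P.b := (min_le_right _ _).trans ((min_le_right _ _).trans (min_le_left _ _))
  have hc : potMin P ≤ P.c :=
    (min_le_right _ _).trans ((min_le_right _ _).trans ((min_le_right _ _).trans (min_le_left _ _)))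
  have hd : potMin P ≤ P.d :=
    (min_le_right _ _).trans ((min_le_right _ _).trans ((min_le_right _ _).trans ((min_le_right _ _).trans (min_le_left _ _))))
  have he : potMin P ≤ P.e :=
    (min_le_right _ _).trans ((min_le_right _ _).trans ((min_le_right _ _).trans ((min_le_right _ _).trans
      ((min_le_right _ _).trans (min_le_left _ _)))))
  have hf : potMin P ≤ P.f :=
    (min_le_right _ _).trans ((min_le_right _ _).trans ((min_le_right _ _).trans ((min_le_right _ _).trans
      ((min_le_right _ _).trans ((min_le_right _ _).trans (min_le_left _ _))))))
  have hg : potMin P ≤ P.g :=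
    (min_le_right _ _).trans ((min_le_right _ _).trans ((min_le_right _ _).trans ((min_le_right _ _).trans
      ((min_le_right _ _).trans ((min_le_right _ _).trans ((min_le_right _ _).trans (min_le_left _ _)))))))
  have hk : potMin P ≤ P.k :=
    (min_le_right _ _).trans ((min_le_right _ _).trans ((min_le_right _ _).trans ((min_le_right _ _).trans
      ((min_le_right _ _).trans ((min_le_right _ _).trans ((min_le_right _ _).trans (min_le_right _ _)))))))
  rcases n with _ | _ | _ | _ | _ <;> rcases v with _ | _ <;> simp only [potOf] <;> linarith

/-- `potMin ≤ pot`. [cite: MadrasSlade1993, §1.2 (elementary counting)] -/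
theorem potMin_le_pot (hV : PotValid T y ρ P) (r q : ℤ) (v : Bool) : potMin P ≤ pot T P r q v :=
  potMin_le_potOf hV _ _

/-- `0 < pot`. [cite: MadrasSlade1993, §1.2 (elementary counting)] -/
theorem pot_pos (hV : PotValid T y ρ P) (r q : ℤ) (v : Bool) : 0 < pot T P r q v :=
  (potMin_pos hV).trans_le (potMin_le_pot hV r q v)

/-- `0 ≤ wArr`. [cite: BeatonBousquetMelouDeGierDuminilCopinGuttmann2014, §3.2 (arXiv v5 p. 10)] -/
theorem wArr_nonneg (T : ℕ) (hy : 0 ≤ y) (r q : ℤ) : 0 ≤ wArr T y r q := by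
  unfold wArr; split_ifs <;> first | exact hy | norm_num

/-- **Sub-harmonicity after a vertical step**: the two horizontal continuations. [cite: MadrasSlade1993, §1.2 (elementary counting)] -/
theorem pot_step_v (hT : 2 ≤ T) (hV : PotValid T y ρ P) {r q : ℤ} (hr0 : 0 ≤ r) (hrT : r ≤ T) (hq : q = 0 ∨ q = 1) :
    2 * (wArr T y r (1 - q) * pot T P r (1 - q) false) ≤ ρ * pot T P r q true := by
  obtain ⟨py, pa, pb, pc, pd, pe, pf, pg, pk, h2, hW, hEh, hEv, hLth, hLtv, hLahf, hLahk, hLav, hMhf, hMhk, hMv⟩ := hV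
  have hT' : (2 : ℤ) ≤ (T : ℤ) := by exact_mod_cast hT
  -- the classes of the current and the successor state, by cases on the row
  have key : ∀ (n₁ n₂ : ℕ) (w : ℝ), cls T r q = n₁ → cls T r (1 - q) = n₂ → wArr T y r (1 - q) = w →
      2 * (w * potOf P n₂ false) ≤ ρ * potOf P n₁ true →
      2 * (wArr T y r (1 - q) * pot T P r (1 - q) false) ≤ ρ * pot T P r q true := by
    intro n₁ n₂ w h1 h2 h3 h
    rw [pot, pot, h1, h2, h3]; exact h
  rcases hq with rfl | rfl
  · -- q = 0: the successor parity is 1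
    have hr : r = 0 ∨ r = 1 ∨ (2 ≤ r ∧ r ≤ (T:ℤ) - 2) ∨ (r = (T:ℤ) - 1 ∧ 3 ≤ T) ∨ r = T := by omega
    rcases hr with rfl | rfl | ⟨h1, h1'⟩ | ⟨rfl, h3⟩ | rfl
    · exact key 1 0 y (by unfold cls; split_ifs <;> omega) (by unfold cls; split_ifs <;> omega)
        (by unfold wArr; split_ifs <;> first | rfl | omega) (by simp only [potOf]; linarith)
    · by_cases hT2 : T = 2
      · subst hT2
        simp only [if_true] at hLtv
        exact key 2 2 1 (by unfold cls; split_ifs <;> omega) (by unfold cls; split_ifs <;> omega)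
          (by unfold wArr; split_ifs <;> first | rfl | omega) (by simp only [potOf]; linarith)
      · exact key 3 2 1 (by unfold cls; split_ifs <;> omega) (by unfold cls; split_ifs <;> omega)
          (by unfold wArr; split_ifs <;> first | rfl | omega) (by simp only [potOf]; linarith)
    · exact key 4 4 1 (by unfold cls; split_ifs <;> omega) (by unfold cls; split_ifs <;> omega)
        (by unfold wArr; split_ifs <;> first | rfl | omega) (by simp only [potOf]; linarith)
    · have hT2 : T ≠ 2 := by omega
      simp only [hT2, if_false] at hLtv
      exact key 2 3 1 (by unfold cls; split_ifs <;> omega) (by unfold cls; split_ifs <;> omega)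
        (by unfold wArr; split_ifs <;> first | rfl | omega) (by simp only [potOf]; linarith)
    · exact key 0 1 1 (by unfold cls; split_ifs <;> omega) (by unfold cls; split_ifs <;> omega)
        (by unfold wArr; split_ifs <;> first | rfl | omega) (by simp only [potOf]; nlinarith)
  · -- q = 1: the successor parity is 0
    have hr : r = 0 ∨ r = 1 ∨ (2 ≤ r ∧ r ≤ (T:ℤ) - 2) ∨ (r = (T:ℤ) - 1 ∧ 3 ≤ T) ∨ r = T := by omega
    rcases hr with rfl | rfl | ⟨h1, h1'⟩ | ⟨rfl, h3⟩ | rfl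
    · exact key 0 1 1 (by unfold cls; split_ifs <;> omega) (by unfold cls; split_ifs <;> omega)
        (by unfold wArr; split_ifs <;> first | rfl | omega) (by simp only [potOf]; nlinarith)
    · by_cases hT2 : T = 2
      · subst hT2
        simp only [if_true] at hLtv
        exact key 2 2 1 (by unfold cls; split_ifs <;> omega) (by unfold cls; split_ifs <;> omega)
          (by unfold wArr; split_ifs <;> first | rfl | omega) (by simp only [potOf]; linarith)
      · simp only [hT2, if_false] at hLtv
        exact key 2 3 1 (by unfold cls; split_ifs <;> omega) (by unfold cls; split_ifs <;> omega)
          (by unfold wArr; split_ifs <;> first | rfl | omega) (by simp only [potOf]; linarith)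
    · exact key 4 4 1 (by unfold cls; split_ifs <;> omega) (by unfold cls; split_ifs <;> omega)
        (by unfold wArr; split_ifs <;> first | rfl | omega) (by simp only [potOf]; linarith)
    · exact key 3 2 1 (by unfold cls; split_ifs <;> omega) (by unfold cls; split_ifs <;> omega)
        (by unfold wArr; split_ifs <;> first | rfl | omega) (by simp only [potOf]; linarith)
    · exact key 1 0 y (by unfold cls; split_ifs <;> omega) (by unfold cls; split_ifs <;> omega)
        (by unfold wArr; split_ifs <;> first | rfl | omega) (by simp only [potOf]; linarith)

/-- **Sub-harmonicity after a horizontal step**: the straight continuation and (when it stays in the strip) the vertical step.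
[cite: MadrasSlade1993, §1.2 (elementary counting)] -/
theorem pot_step_h (hT : 2 ≤ T) (hV : PotValid T y ρ P) {r q : ℤ} (hr0 : 0 ≤ r) (hrT : r ≤ T) (hq : q = 0 ∨ q = 1) :
    wArr T y r (1 - q) * pot T P r (1 - q) false +
        (if 0 ≤ vRow r q ∧ vRow r q ≤ (T : ℤ) then wArr T y (vRow r q) (1 - q) * pot T P (vRow r q) (1 - q) true else 0) ≤
      ρ * pot T P r q false := by
  obtain ⟨py, pa, pb, pc, pd, pe, pf, pg, pk, h2, hW, hEh, hEv, hLth, hLtv, hLahf, hLahk, hLav, hMhf, hMhk, hMv⟩ := hV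
  have hT' : (2 : ℤ) ≤ (T : ℤ) := by exact_mod_cast hT
  -- with a vertical successor of row `r'`
  have keyV : ∀ (n₀ n₁ n₂ : ℕ) (w₁ w₂ : ℝ) (r' : ℤ), vRow r q = r' → 0 ≤ r' → r' ≤ (T : ℤ) →
      cls T r q = n₀ → cls T r (1 - q) = n₁ → cls T r' (1 - q) = n₂ → wArr T y r (1 - q) = w₁ → wArr T y r' (1 - q) = w₂ →
      w₁ * potOf P n₁ false + w₂ * potOf P n₂ true ≤ ρ * potOf P n₀ false →
      wArr T y r (1 - q) * pot T P r (1 - q) false +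
        (if 0 ≤ vRow r q ∧ vRow r q ≤ (T : ℤ) then wArr T y (vRow r q) (1 - q) * pot T P (vRow r q) (1 - q) true else 0) ≤
      ρ * pot T P r q false := by
    intro n₀ n₁ n₂ w₁ w₂ r' hr' h0' hT'' c0 c1 c2 e1 e2 h
    rw [if_pos (by rw [hr']; exact ⟨h0', hT''⟩), hr', pot, pot, pot, c0, c1, c2, e1, e2]; exact h
  -- without a vertical successor
  have keyN : ∀ (n₀ n₁ : ℕ) (w₁ : ℝ), ¬ (0 ≤ vRow r q ∧ vRow r q ≤ (T : ℤ)) →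
      cls T r q = n₀ → cls T r (1 - q) = n₁ → wArr T y r (1 - q) = w₁ →
      w₁ * potOf P n₁ false ≤ ρ * potOf P n₀ false →
      wArr T y r (1 - q) * pot T P r (1 - q) false +
        (if 0 ≤ vRow r q ∧ vRow r q ≤ (T : ℤ) then wArr T y (vRow r q) (1 - q) * pot T P (vRow r q) (1 - q) true else 0) ≤
      ρ * pot T P r q false := by
    intro n₀ n₁ w₁ hn c0 c1 e1 h
    rw [if_neg hn, add_zero, pot, pot, c0, c1, e1]; exact h
  rcases hq with rfl | rfl
  · -- q = 0: vertical bond up, r' = r + 1; successor parity 1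
    have hv : vRow r 0 = r + 1 := by simp [vRow]
    have hr : r = 0 ∨ (r = 1 ∧ T = 2) ∨ (r = 1 ∧ T = 3) ∨ (r = 1 ∧ 4 ≤ T) ∨ (2 ≤ r ∧ r ≤ (T:ℤ) - 3) ∨
        (r = (T:ℤ) - 2 ∧ 4 ≤ T) ∨ (r = (T:ℤ) - 1 ∧ 3 ≤ T) ∨ r = T := by omega
    rcases hr with rfl | ⟨rfl, hT2⟩ | ⟨rfl, hT3⟩ | ⟨rfl, hT4⟩ | ⟨h1, h1'⟩ | ⟨rfl, hT4⟩ | ⟨rfl, hT3⟩ | rfl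
    · -- E_h → W (weight y) + Lt_v
      exact keyV 1 0 2 y 1 1 (by rw [hv]; ring) (by norm_num) (by omega)
        (by unfold cls; split_ifs <;> omega) (by unfold cls; split_ifs <;> omega) (by unfold cls; split_ifs <;> omega)
        (by unfold wArr; split_ifs <;> first | rfl | omega) (by unfold wArr; split_ifs <;> first | rfl | omega)
        (by simp only [potOf]; linarith)
    · -- T = 2, row 1: Lt_h → Lt_h (top) + E_v (top)
      subst hT2
      simp only [if_true] at hLth
      exact keyV 2 2 1 1 1 2 (by rw [hv]; ring) (by norm_num) (by omega)
        (by unfold cls; split_ifs <;> omega) (by unfold cls; split_ifs <;> omega) (by unfold cls; split_ifs <;> omega)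
        (by unfold wArr; split_ifs <;> first | rfl | omega) (by unfold wArr; split_ifs <;> first | rfl | omega)
        (by simp only [potOf]; linarith)
    · -- T = 3, row 1, q = 0: La_h → Lt_h + La_v (top)
      subst hT3
      exact keyV 3 2 3 1 1 2 (by rw [hv]; ring) (by norm_num) (by omega)
        (by unfold cls; split_ifs <;> omega) (by unfold cls; split_ifs <;> omega) (by unfold cls; split_ifs <;> omega)
        (by unfold wArr; split_ifs <;> first | rfl | omega) (by unfold wArr; split_ifs <;> first | rfl | omega)
        (by simp only [potOf]; linarith)
    · -- T ≥ 4, row 1, q = 0: La_h → Lt_h + M_v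
      exact keyV 3 2 4 1 1 2 (by rw [hv]; ring) (by norm_num) (by omega)
        (by unfold cls; split_ifs <;> omega) (by unfold cls; split_ifs <;> omega) (by unfold cls; split_ifs <;> omega)
        (by unfold wArr; split_ifs <;> first | rfl | omega) (by unfold wArr; split_ifs <;> first | rfl | omega)
        (by simp only [potOf]; linarith)
    · -- bulk → bulk + bulk
      exact keyV 4 4 4 1 1 (r + 1) (by rw [hv]) (by omega) (by omega)
        (by unfold cls; split_ifs <;> omega) (by unfold cls; split_ifs <;> omega) (by unfold cls; split_ifs <;> omega)
        (by unfold wArr; split_ifs <;> first | rfl | omega) (by unfold wArr; split_ifs <;> first | rfl | omega)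
        (by simp only [potOf]; linarith)
    · -- row T-2 (T ≥ 4), q = 0: M_h → M_h + La_v (top)
      exact keyV 4 4 3 1 1 ((T:ℤ) - 1) (by rw [hv]; ring) (by omega) (by omega)
        (by unfold cls; split_ifs <;> omega) (by unfold cls; split_ifs <;> omega) (by unfold cls; split_ifs <;> omega)
        (by unfold wArr; split_ifs <;> first | rfl | omega) (by unfold wArr; split_ifs <;> first | rfl | omega)
        (by simp only [potOf]; linarith)
    · -- row T-1 (T ≥ 3), q = 0: Lt_h (top) → La_h (top) + E_v (top)
      have hT2 : T ≠ 2 := by omega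
      simp only [hT2, if_false] at hLth
      exact keyV 2 3 1 1 1 T (by rw [hv]; ring) (by omega) le_rfl
        (by unfold cls; split_ifs <;> omega) (by unfold cls; split_ifs <;> omega) (by unfold cls; split_ifs <;> omega)
        (by unfold wArr; split_ifs <;> first | rfl | omega) (by unfold wArr; split_ifs <;> first | rfl | omega)
        (by simp only [potOf]; linarith)
    · -- row T, q = 0: W_h (top) → E_h (top), no vertical successor
      exact keyN 0 1 1 (by rw [hv]; omega)
        (by unfold cls; split_ifs <;> omega) (by unfold cls; split_ifs <;> omega)
        (by unfold wArr; split_ifs <;> first | rfl | omega) (by simp only [potOf]; linarith)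
  · -- q = 1: vertical bond down, r' = r - 1; successor parity 0
    have hv : vRow r 1 = r - 1 := by simp [vRow]
    have hr : r = 0 ∨ (r = 1 ∧ T = 2) ∨ (r = 1 ∧ 3 ≤ T) ∨ (r = 2 ∧ 4 ≤ T) ∨ (3 ≤ r ∧ r ≤ (T:ℤ) - 2) ∨
        (r = (T:ℤ) - 1 ∧ T = 3) ∨ (r = (T:ℤ) - 1 ∧ 4 ≤ T) ∨ r = T := by omega
    rcases hr with rfl | ⟨rfl, hT2⟩ | ⟨rfl, hT3⟩ | ⟨rfl, hT4⟩ | ⟨h1, h1'⟩ | ⟨rfl, hT3⟩ | ⟨rfl, hT4⟩ | rfl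
    · -- row 0, q = 1: W_h → E_h, no vertical successor
      exact keyN 0 1 1 (by rw [hv]; omega)
        (by unfold cls; split_ifs <;> omega) (by unfold cls; split_ifs <;> omega)
        (by unfold wArr; split_ifs <;> first | rfl | omega) (by simp only [potOf]; linarith)
    · -- T = 2, row 1, q = 1: Lt_h → Lt_h (top) + E_v (bottom)
      subst hT2
      simp only [if_true] at hLth
      exact keyV 2 2 1 1 1 0 (by rw [hv]; ring) le_rfl (by omega)
        (by unfold cls; split_ifs <;> omega) (by unfold cls; split_ifs <;> omega) (by unfold cls; split_ifs <;> omega)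
        (by unfold wArr; split_ifs <;> first | rfl | omega) (by unfold wArr; split_ifs <;> first | rfl | omega)
        (by simp only [potOf]; linarith)
    · -- T ≥ 3, row 1, q = 1: Lt_h → La_h + E_v
      have hT2 : T ≠ 2 := by omega
      simp only [hT2, if_false] at hLth
      exact keyV 2 3 1 1 1 0 (by rw [hv]; ring) le_rfl (by omega)
        (by unfold cls; split_ifs <;> omega) (by unfold cls; split_ifs <;> omega) (by unfold cls; split_ifs <;> omega)
        (by unfold wArr; split_ifs <;> first | rfl | omega) (by unfold wArr; split_ifs <;> first | rfl | omega)
        (by simp only [potOf]; linarith)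
    · -- T ≥ 4, row 2, q = 1: M_h → M_h + La_v
      exact keyV 4 4 3 1 1 1 (by rw [hv]; ring) (by norm_num) (by omega)
        (by unfold cls; split_ifs <;> omega) (by unfold cls; split_ifs <;> omega) (by unfold cls; split_ifs <;> omega)
        (by unfold wArr; split_ifs <;> first | rfl | omega) (by unfold wArr; split_ifs <;> first | rfl | omega)
        (by simp only [potOf]; linarith)
    · -- bulk → bulk + bulk
      exact keyV 4 4 4 1 1 (r - 1) (by rw [hv]) (by omega) (by omega)
        (by unfold cls; split_ifs <;> omega) (by unfold cls; split_ifs <;> omega) (by unfold cls; split_ifs <;> omega)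
        (by unfold wArr; split_ifs <;> first | rfl | omega) (by unfold wArr; split_ifs <;> first | rfl | omega)
        (by simp only [potOf]; linarith)
    · -- T = 3, row 2 = T-1, q = 1: La_h (top) → Lt_h (top) + La_v (bottom row 1)
      subst hT3
      exact keyV 3 2 3 1 1 1 (by rw [hv]; push_cast) (by norm_num) (by omega)
        (by unfold cls; split_ifs <;> omega) (by unfold cls; split_ifs <;> omega) (by unfold cls; split_ifs <;> omega)
        (by unfold wArr; split_ifs <;> first | rfl | omega) (by unfold wArr; split_ifs <;> first | rfl | omega)
        (by simp only [potOf]; linarith)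
    · -- T ≥ 4, row T-1, q = 1: La_h (top) → Lt_h (top) + M_v
      exact keyV 3 2 4 1 1 ((T:ℤ) - 2) (by rw [hv]; ring) (by omega) (by omega)
        (by unfold cls; split_ifs <;> omega) (by unfold cls; split_ifs <;> omega) (by unfold cls; split_ifs <;> omega)
        (by unfold wArr; split_ifs <;> first | rfl | omega) (by unfold wArr; split_ifs <;> first | rfl | omega)
        (by simp only [potOf]; linarith)
    · -- row T, q = 1: E_h (top) → W (top, weight y) + Lt_v (top)
      exact keyV 1 0 2 y 1 ((T:ℤ) - 1) (by rw [hv]) (by omega) (by omega)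
        (by unfold cls; split_ifs <;> omega) (by unfold cls; split_ifs <;> omega) (by unfold cls; split_ifs <;> omega)
        (by unfold wArr; split_ifs <;> first | rfl | omega) (by unfold wArr; split_ifs <;> first | rfl | omega)
        (by simp only [potOf]; linarith)

/-! ### §2 Strip walks: the last step is one of the two (three) non-backtracking moves -/

variable {N : ℕ} {p p' : Site 2 × (ℕ → Site 2)}

/-- The `m`-th site of a placed walk. [cite: MadrasSlade1993, §8.2, eq. (8.2.1)] -/
def siteAt (p : Site 2 × (ℕ → Site 2)) (m : ℕ) : Site 2 := p.1 + p.2 m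

/-- Its row. [cite: MadrasSlade1993, §8.2, eq. (8.2.1)] -/
def rowAt (p : Site 2 × (ℕ → Site 2)) (m : ℕ) : ℤ := siteAt p m 1

/-- Its bond parity `(x + r) mod 2`. [cite: EntingJensen2009, §7.4.2, Fig. 7.10] -/
def parAt (p : Site 2 × (ℕ → Site 2)) (m : ℕ) : ℤ := (siteAt p m 0 + siteAt p m 1) % 2

/-- Whether the step `m → m+1` is vertical. [cite: EntingJensen2009, §7.4.2, Fig. 7.10] -/
def vertAt (p : Site 2 × (ℕ → Site 2)) (m : ℕ) : Bool := decide (siteAt p (m + 1) 0 = siteAt p m 0)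

/-- The prefix of length `N`. [cite: MadrasSlade1993, §8.2, eq. (8.2.2)] -/
def pref (N : ℕ) (p : Site 2 × (ℕ → Site 2)) : Site 2 × (ℕ → Site 2) := (p.1, fun i => p.2 (min i N))

/-- The prefix of a strip walk is a strip walk. [cite: MadrasSlade1993, §8.2, eq. (8.2.2)] -/
theorem pref_mem (hp : p ∈ stripPairs T (N + 1)) : pref N p ∈ stripPairs T N :=
  (Finset.mem_product.1 (split_mem hp)).1

/-- Sites of the prefix. [cite: MadrasSlade1993, §8.2, eq. (8.2.2)] -/
theorem siteAt_pref {m : ℕ} (hm : m ≤ N) : siteAt (pref N p) m = siteAt p m := by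
  simp [siteAt, pref, min_eq_left hm]

/-- Sites agree with those of a walk having this prefix. [cite: MadrasSlade1993, §8.2, eq. (8.2.2)] -/
theorem siteAt_eq_of_pref_eq (h : pref N p = p') {m : ℕ} (hm : m ≤ N) : siteAt p m = siteAt p' m := by
  rw [← h]; exact (siteAt_pref hm).symm

/-- The parity is `0` or `1`. [cite: EntingJensen2009, §7.4.2, Fig. 7.10] -/
theorem parAt_cases (p : Site 2 × (ℕ → Site 2)) (m : ℕ) : parAt p m = 0 ∨ parAt p m = 1 := by
  unfold parAt; omega

/-- **The last step** in coordinates: it is a brick-wall bond. [cite: EntingJensen2009, §7.4.2, Fig. 7.10 (vertical bonds {(x,y),(x,y+1)} with x+y even)] -/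
theorem last_step_coord (hp : p ∈ stripPairs T (N + 1)) :
    ((siteAt p (N + 1) 0 = siteAt p N 0 + 1 ∨ siteAt p N 0 = siteAt p (N + 1) 0 + 1) ∧ siteAt p (N + 1) 1 = siteAt p N 1) ∨
      (siteAt p (N + 1) 0 = siteAt p N 0 ∧
        ((siteAt p (N + 1) 1 = siteAt p N 1 + 1 ∧ (siteAt p N 0 + siteAt p N 1) % 2 = 0) ∨
          (siteAt p N 1 = siteAt p (N + 1) 1 + 1 ∧ (siteAt p (N + 1) 0 + siteAt p (N + 1) 1) % 2 = 0))) := by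
  obtain ⟨-, -, hbw, -⟩ := mem_stripPairs.1 hp
  have hadj : brickWallGraph.Adj (siteAt p N) (siteAt p (N + 1)) := hbw N (Nat.lt_succ_self N)
  rwa [brickWallGraph_adj_coord] at hadj

/-- **The last step**: it flips the parity, and it is either vertical along the bond prescribed by the parity, or horizontal.
[cite: EntingJensen2009, §7.4.2, Fig. 7.10 (vertical bonds {(x,y),(x,y+1)} with x+y even)] -/
theorem last_step (hp : p ∈ stripPairs T (N + 1)) :
    parAt p (N + 1) = 1 - parAt p N ∧
      ((vertAt p N = true ∧ rowAt p (N + 1) = vRow (rowAt p N) (parAt p N) ∧ siteAt p (N + 1) 0 = siteAt p N 0) ∨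
       (vertAt p N = false ∧ rowAt p (N + 1) = rowAt p N ∧
          (siteAt p (N + 1) 0 = siteAt p N 0 + 1 ∨ siteAt p (N + 1) 0 = siteAt p N 0 - 1))) := by
  have h := last_step_coord hp
  unfold parAt rowAt vertAt vRow
  simp only [decide_eq_true_eq, decide_eq_false_iff_not]
  omega

/-- In the strip: `0 ≤ row ≤ T`. [cite: MadrasSlade1993, §8.2, eq. (8.2.1)] -/
theorem rowAt_mem (hp : p ∈ stripPairs T N) {m : ℕ} (hm : m ≤ N) : 0 ≤ rowAt p m ∧ rowAt p m ≤ (T : ℤ) :=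
  (mem_stripPairs.1 hp).2.2.2 m hm

/-- **Non-backtracking**: the site two steps later is not the earlier site. [cite: MadrasSlade1993, §1.2 (self-avoidance)] -/
theorem siteAt_add_two_ne (hp : p ∈ stripPairs T (N + 1 + 1)) : siteAt p (N + 1 + 1) ≠ siteAt p N := by
  obtain ⟨-, hω, -, -⟩ := mem_stripPairs.1 hp
  obtain ⟨-, -, -, hinj⟩ := Zd.mem_saws.1 hω
  intro h
  have h' : p.2 (N + 1 + 1) = p.2 N := add_left_cancel h
  have := hinj (show N + 1 + 1 ∈ {i | i ≤ N + 1 + 1} by simp) (show N ∈ {i | i ≤ N + 1 + 1} by simp only [Set.mem_setOf_eq]; omega) h'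
  omega

/-- `bc` grows by the bottom indicator. [cite: BeatonBousquetMelouDeGierDuminilCopinGuttmann2014, §3.2 (arXiv v5 p. 10: bc(ω))] -/
theorem bottomVisits₀_succ' (a : Site 2) (υ : ℕ → Site 2) (n : ℕ) :
    bottomVisits₀ a υ (n + 1) = bottomVisits₀ a υ n + (if (a + υ (n + 1)) 1 = 0 ∧ (a + υ (n + 1)) 0 % 2 = 1 then 1 else 0) :=
  Finset.sum_range_succ _ _

/-- `tc` grows by the top indicator. [cite: BeatonBousquetMelouDeGierDuminilCopinGuttmann2014, §3.2 (arXiv v5 p. 10: tc(ω))] -/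
theorem topVisits₀_succ' (T : ℕ) (a : Site 2) (υ : ℕ → Site 2) (n : ℕ) :
    topVisits₀ T a υ (n + 1) = topVisits₀ T a υ n + (if (a + υ (n + 1)) 1 = (T : ℤ) ∧ ((a + υ (n + 1)) 0 + T) % 2 = 0 then 1 else 0) :=
  Finset.sum_range_succ _ _

/-- The visit count grows by the wall indicator of the new site. [cite: BeatonBousquetMelouDeGierDuminilCopinGuttmann2014, §3.2 (arXiv v5 p. 10: bc(ω), tc(ω))] -/
theorem visits_succ (hT : 1 ≤ T) (p : Site 2 × (ℕ → Site 2)) (N : ℕ) :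
    bottomVisits₀ p.1 p.2 (N + 1) + topVisits₀ T p.1 p.2 (N + 1) =
      bottomVisits₀ p.1 p.2 N + topVisits₀ T p.1 p.2 N +
        (if (rowAt p (N + 1) = 0 ∧ parAt p (N + 1) = 1) ∨ (rowAt p (N + 1) = (T : ℤ) ∧ parAt p (N + 1) = 0) then 1 else 0) := by
  rw [bottomVisits₀_succ', topVisits₀_succ']
  unfold rowAt parAt siteAt
  have hT' : (1 : ℤ) ≤ (T : ℤ) := by exact_mod_cast hT
  split_ifs <;> omega

/-- Hence the weight grows by the factor `wArr`. [cite: BeatonBousquetMelouDeGierDuminilCopinGuttmann2014, §3.2 (arXiv v5 p. 10)] -/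
theorem pow_visits_succ (hT : 1 ≤ T) (y : ℝ) (p : Site 2 × (ℕ → Site 2)) (N : ℕ) :
    y ^ (bottomVisits₀ p.1 p.2 (N + 1) + topVisits₀ T p.1 p.2 (N + 1)) =
      y ^ (bottomVisits₀ p.1 p.2 N + topVisits₀ T p.1 p.2 N) * wArr T y (rowAt p (N + 1)) (parAt p (N + 1)) := by
  rw [visits_succ hT]
  unfold wArr
  split_ifs <;> simp [pow_succ]

/-- The prefix has the visits of the walk up to time `N`. [cite: BeatonBousquetMelouDeGierDuminilCopinGuttmann2014, §3.2 (arXiv v5 p. 10)] -/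
theorem visits_pref (T : ℕ) (p : Site 2 × (ℕ → Site 2)) (N : ℕ) :
    bottomVisits₀ (pref N p).1 (pref N p).2 N + topVisits₀ T (pref N p).1 (pref N p).2 N =
      bottomVisits₀ p.1 p.2 N + topVisits₀ T p.1 p.2 N := by
  unfold bottomVisits₀ topVisits₀ pref
  congr 1
  · refine Finset.sum_congr rfl fun m hm => ?_
    have := Finset.mem_range.1 hm; simp only [min_eq_left (by omega : m ≤ N)]
  · refine Finset.sum_congr rfl fun m hm => ?_
    have := Finset.mem_range.1 hm; simp only [min_eq_left (by omega : m ≤ N)]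

/-- The code of the last step of a walk of length `N + 2`: `2` = vertical, `0` = to the right, `1` = to the left. [cite: EntingJensen2009, §7.4.2, Fig. 7.10] -/
def lastCode (N : ℕ) (p : Site 2 × (ℕ → Site 2)) : ℕ :=
  if vertAt p (N + 1) = true then 2 else if siteAt p (N + 1 + 1) 0 = siteAt p (N + 1) 0 + 1 then 0 else 1

/-- The value bound attached to a code, seen from the state `(r, q)` at time `N + 1`. [cite: MadrasSlade1993, §1.2 (elementary counting)] -/
def codeVal (T : ℕ) (y : ℝ) (P : PotVals) (r q : ℤ) (c : ℕ) : ℝ :=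
  if c = 2 then (if 0 ≤ vRow r q ∧ vRow r q ≤ (T : ℤ) then wArr T y (vRow r q) (1 - q) * pot T P (vRow r q) (1 - q) true else 0)
  else wArr T y r (1 - q) * pot T P r (1 - q) false

/-- `0 ≤ codeVal`. [cite: MadrasSlade1993, §1.2 (elementary counting)] -/
theorem codeVal_nonneg (hV : PotValid T y ρ P) (r q : ℤ) (c : ℕ) : 0 ≤ codeVal T y P r q c := by
  have hy := hV.pos_y.le
  unfold codeVal
  split_ifs
  · exact mul_nonneg (wArr_nonneg T hy _ _) (pot_pos hV _ _ _).le
  · exact le_rfl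
  · exact mul_nonneg (wArr_nonneg T hy _ _) (pot_pos hV _ _ _).le

/-- A walk of length `N+2` is determined by its prefix of length `N+1` and its last site. [cite: MadrasSlade1993, §8.2, eq. (8.2.2)] -/
theorem eq_of_pref_eq_of_siteAt_eq {p₁ p₂ : Site 2 × (ℕ → Site 2)} (h₁ : p₁ ∈ stripPairs T (N + 1 + 1))
    (h₂ : p₂ ∈ stripPairs T (N + 1 + 1)) (hpre : pref (N + 1) p₁ = pref (N + 1) p₂)
    (hlast : siteAt p₁ (N + 1 + 1) = siteAt p₂ (N + 1 + 1)) : p₁ = p₂ := by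
  obtain ⟨-, hω₁, -, -⟩ := mem_stripPairs.1 h₁
  obtain ⟨-, hω₂, -, -⟩ := mem_stripPairs.1 h₂
  obtain ⟨-, hend₁, -, -⟩ := Zd.mem_saws.1 hω₁
  obtain ⟨-, hend₂, -, -⟩ := Zd.mem_saws.1 hω₂
  have h1 : p₁.1 = p₂.1 := by have := congrArg Prod.fst hpre; simpa [pref] using this
  have hfun : ∀ i ≤ N + 1, p₁.2 i = p₂.2 i := fun i hi => by
    have := congrFun (congrArg Prod.snd hpre) i
    simpa [pref, min_eq_left hi] using this
  have hN2 : p₁.2 (N + 1 + 1) = p₂.2 (N + 1 + 1) := by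
    unfold siteAt at hlast; rw [h1] at hlast; exact add_left_cancel hlast
  refine Prod.ext h1 (funext fun i => ?_)
  rcases Nat.lt_or_ge i (N + 1 + 1) with hi | hi
  · exact hfun i (by omega)
  · rw [hend₁ i hi, hend₂ i hi, hN2]

open Classical in
/-- **The fibre inequality**: over the walks of length `N+2` with a given prefix of length `N+1`, the new arrival weight times the
new potential sums to at most `ρ` times the potential of the prefix. [cite: MadrasSlade1993, §1.2 (elementary counting); EntingJensen2009, §7.4.2, Fig. 7.10] -/
theorem sum_fibre_le (hT : 2 ≤ T) (hV : PotValid T y ρ P) (hp' : p' ∈ stripPairs T (N + 1)) :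
    ∑ p ∈ (stripPairs T (N + 1 + 1)).filter (fun p => pref (N + 1) p = p'),
        wArr T y (rowAt p (N + 1 + 1)) (parAt p (N + 1 + 1)) *
          pot T P (rowAt p (N + 1 + 1)) (parAt p (N + 1 + 1)) (vertAt p (N + 1)) ≤
      ρ * pot T P (rowAt p' (N + 1)) (parAt p' (N + 1)) (vertAt p' N) := by
  set F := (stripPairs T (N + 1 + 1)).filter (fun p => pref (N + 1) p = p') with hF
  set r := rowAt p' (N + 1) with hr
  set q := parAt p' (N + 1) with hq
  have hrq := rowAt_mem hp' (le_refl (N + 1))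
  rw [← hr] at hrq
  have hq01 : q = 0 ∨ q = 1 := parAt_cases p' (N + 1)
  -- anatomy of a member of the fibre
  have anat : ∀ p ∈ F, p ∈ stripPairs T (N + 1 + 1) ∧ pref (N + 1) p = p' ∧ rowAt p (N + 1) = r ∧ parAt p (N + 1) = q ∧
      siteAt p (N + 1) 0 = siteAt p' (N + 1) 0 ∧ siteAt p (N + 1) 1 = siteAt p' (N + 1) 1 ∧
      siteAt p N 0 = siteAt p' N 0 ∧ siteAt p N 1 = siteAt p' N 1 := by
    intro p hp
    obtain ⟨hpS, hpre⟩ := Finset.mem_filter.1 hp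
    have e1 := siteAt_eq_of_pref_eq hpre (le_refl (N + 1))
    have e0 := siteAt_eq_of_pref_eq hpre (Nat.le_succ N)
    exact ⟨hpS, hpre, by rw [hr, rowAt, rowAt, e1], by rw [hq, parAt, parAt, e1], by rw [e1], by rw [e1], by rw [e0], by rw [e0]⟩
  -- (i) the summand is the code value
  have hval : ∀ p ∈ F, wArr T y (rowAt p (N + 1 + 1)) (parAt p (N + 1 + 1)) *
      pot T P (rowAt p (N + 1 + 1)) (parAt p (N + 1 + 1)) (vertAt p (N + 1)) = codeVal T y P r q (lastCode N p) := by
    intro p hp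
    obtain ⟨hpS, -, hr1, hq1, -, -, -, -⟩ := anat p hp
    obtain ⟨hpar, hstep⟩ := last_step (N := N + 1) hpS
    rw [hr1] at hstep
    rw [hq1] at hstep hpar
    rcases hstep with ⟨hv, hrow, -⟩ | ⟨hv, hrow, hx⟩
    · have hc : lastCode N p = 2 := by simp [lastCode, hv]
      have hin := rowAt_mem hpS (le_refl (N + 1 + 1))
      rw [hc, codeVal, if_pos rfl, hrow, if_pos (by rw [← hrow]; exact hin), hpar, hv]
    · have hc : lastCode N p ≠ 2 := by
        simp only [lastCode, hv, Bool.false_eq_true, if_false]; split_ifs <;> omega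
      rw [codeVal, if_neg hc, hrow, hpar, hv]
  -- (ii) the code is injective on the fibre
  have hinj : Set.InjOn (lastCode N) ↑F := by
    intro p₁ h₁ p₂ h₂ hc
    rw [Finset.mem_coe] at h₁ h₂
    obtain ⟨hS₁, hpre₁, -, -, hx₁, hy₁, -, -⟩ := anat p₁ h₁
    obtain ⟨hS₂, hpre₂, -, -, hx₂, hy₂, -, -⟩ := anat p₂ h₂
    refine eq_of_pref_eq_of_siteAt_eq hS₁ hS₂ (hpre₁.trans hpre₂.symm) ?_
    have hs₁ := last_step_coord (N := N + 1) hS₁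
    have hs₂ := last_step_coord (N := N + 1) hS₂
    unfold lastCode vertAt at hc
    simp only [decide_eq_true_eq] at hc
    rw [site_two_eq_iff]
    split_ifs at hc <;> omega
  -- (iii) the image of the fibre lies in the allowed codes, (iv) whose values sum to at most `ρ · pot`
  have hsum : ∑ p ∈ F, wArr T y (rowAt p (N + 1 + 1)) (parAt p (N + 1 + 1)) *
      pot T P (rowAt p (N + 1 + 1)) (parAt p (N + 1 + 1)) (vertAt p (N + 1)) = ∑ c ∈ F.image (lastCode N), codeVal T y P r q c := by
    rw [Finset.sum_image hinj]
    exact Finset.sum_congr rfl hval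
  rw [hsum]
  obtain ⟨hpar', hstep'⟩ := last_step hp'
  have hs' := last_step_coord hp'
  rcases hstep' with ⟨hv', hrow', hx'⟩ | ⟨hv', hrow', hx'⟩
  · -- after a vertical step: codes ⊆ {0, 1} (no second vertical step: it would backtrack)
    have hsub : F.image (lastCode N) ⊆ ({0, 1} : Finset ℕ) := by
      intro c hc
      obtain ⟨p, hp, rfl⟩ := Finset.mem_image.1 hc
      obtain ⟨hpS, -, -, -, hx1, hy1, hx0, hy0⟩ := anat p hp
      have hs := last_step_coord (N := N + 1) hpS
      have hne := siteAt_add_two_ne hpS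
      rw [Ne, site_two_eq_iff] at hne
      rw [Finset.mem_insert, Finset.mem_singleton]
      unfold lastCode vertAt
      simp only [decide_eq_true_eq]
      split_ifs <;> omega
    refine (Finset.sum_le_sum_of_subset_of_nonneg hsub fun c _ _ => codeVal_nonneg hV r q c).trans ?_
    rw [Finset.sum_pair (by norm_num), hv']
    have h := pot_step_v hT hV hrq.1 hrq.2 hq01
    simp only [codeVal, show (0:ℕ) ≠ 2 by norm_num, show (1:ℕ) ≠ 2 by norm_num, if_false]
    linarith
  · -- after a horizontal step: codes ⊆ {c₀, 2} (the reverse horizontal step would backtrack)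
    set c₀ : ℕ := if siteAt p' (N + 1) 0 = siteAt p' N 0 + 1 then 0 else 1 with hc₀
    have hc₀2 : c₀ ≠ 2 := by rw [hc₀]; split_ifs <;> omega
    have hsub : F.image (lastCode N) ⊆ ({c₀, 2} : Finset ℕ) := by
      intro c hc
      obtain ⟨p, hp, rfl⟩ := Finset.mem_image.1 hc
      obtain ⟨hpS, -, -, -, hx1, hy1, hx0, hy0⟩ := anat p hp
      have hs := last_step_coord (N := N + 1) hpS
      have hne := siteAt_add_two_ne hpS
      rw [Ne, site_two_eq_iff] at hne
      rw [Finset.mem_insert, Finset.mem_singleton, hc₀]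
      unfold lastCode vertAt
      unfold vertAt at hv'
      simp only [decide_eq_true_eq]
      simp only [decide_eq_false_iff_not] at hv'
      split_ifs <;> omega
    refine (Finset.sum_le_sum_of_subset_of_nonneg hsub fun c _ _ => codeVal_nonneg hV r q c).trans ?_
    rw [Finset.sum_pair hc₀2, hv']
    have h := pot_step_h hT hV hrq.1 hrq.2 hq01
    simp only [codeVal, hc₀2, if_false, if_true]
    exact h

/-! ### §3 The potential-weighted partition function is sub-geometric; `μ_T(y,y) ≤ ρ` -/

/-- The potential-weighted two-wall partition function at length `N + 1`: `Σ_ω y^{bc+tc} · pot(state after the last step)`.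
[cite: BeatonBousquetMelouDeGierDuminilCopinGuttmann2014, §3.2 (arXiv v5 p. 10: C_{T,k}(y,z)); MadrasSlade1993, §1.2 (elementary counting)] -/
def potSum (T : ℕ) (y : ℝ) (P : PotVals) (N : ℕ) : ℝ :=
  ∑ p ∈ stripPairs T (N + 1), y ^ (bottomVisits₀ p.1 p.2 (N + 1) + topVisits₀ T p.1 p.2 (N + 1)) *
    pot T P (rowAt p (N + 1)) (parAt p (N + 1)) (vertAt p N)

/-- `0 ≤ potSum`. [cite: MadrasSlade1993, §1.2 (elementary counting)] -/
theorem potSum_nonneg (hV : PotValid T y ρ P) (N : ℕ) : 0 ≤ potSum T y P N :=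
  Finset.sum_nonneg fun _ _ => mul_nonneg (pow_nonneg hV.pos_y.le _) (pot_pos hV _ _ _).le

open Classical in
/-- **One step costs at most a factor `ρ`**: `potSum (N+1) ≤ ρ · potSum N` (fibrewise over the prefix, by `sum_fibre_le`).
[cite: MadrasSlade1993, §1.2 (elementary counting); BeatonBousquetMelouDeGierDuminilCopinGuttmann2014, §3.2 (arXiv v5 p. 10)] -/
theorem potSum_succ_le (hT : 2 ≤ T) (hV : PotValid T y ρ P) (N : ℕ) : potSum T y P (N + 1) ≤ ρ * potSum T y P N := by
  have hT1 : 1 ≤ T := by omega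
  unfold potSum
  have hmaps : ∀ p ∈ stripPairs T (N + 1 + 1), pref (N + 1) p ∈ stripPairs T (N + 1) := fun p hp => pref_mem hp
  rw [← Finset.sum_fiberwise_of_maps_to hmaps, Finset.mul_sum]
  refine Finset.sum_le_sum fun p' hp' => ?_
  have hfib : ∀ p ∈ (stripPairs T (N + 1 + 1)).filter (fun p => pref (N + 1) p = p'),
      y ^ (bottomVisits₀ p.1 p.2 (N + 1 + 1) + topVisits₀ T p.1 p.2 (N + 1 + 1)) *
          pot T P (rowAt p (N + 1 + 1)) (parAt p (N + 1 + 1)) (vertAt p (N + 1)) =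
        y ^ (bottomVisits₀ p'.1 p'.2 (N + 1) + topVisits₀ T p'.1 p'.2 (N + 1)) *
          (wArr T y (rowAt p (N + 1 + 1)) (parAt p (N + 1 + 1)) *
            pot T P (rowAt p (N + 1 + 1)) (parAt p (N + 1 + 1)) (vertAt p (N + 1))) := by
    intro p hp
    obtain ⟨-, hpre⟩ := Finset.mem_filter.1 hp
    rw [pow_visits_succ hT1, ← hpre, visits_pref, mul_assoc]
  rw [Finset.sum_congr rfl hfib, ← Finset.mul_sum]
  have hy0 : 0 ≤ y ^ (bottomVisits₀ p'.1 p'.2 (N + 1) + topVisits₀ T p'.1 p'.2 (N + 1)) := pow_nonneg hV.pos_y.le _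
  calc y ^ (bottomVisits₀ p'.1 p'.2 (N + 1) + topVisits₀ T p'.1 p'.2 (N + 1)) *
        ∑ p ∈ (stripPairs T (N + 1 + 1)).filter (fun p => pref (N + 1) p = p'),
          wArr T y (rowAt p (N + 1 + 1)) (parAt p (N + 1 + 1)) *
            pot T P (rowAt p (N + 1 + 1)) (parAt p (N + 1 + 1)) (vertAt p (N + 1))
      ≤ y ^ (bottomVisits₀ p'.1 p'.2 (N + 1) + topVisits₀ T p'.1 p'.2 (N + 1)) *
          (ρ * pot T P (rowAt p' (N + 1)) (parAt p' (N + 1)) (vertAt p' N)) :=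
        mul_le_mul_of_nonneg_left (sum_fibre_le hT hV hp') hy0
    _ = ρ * (y ^ (bottomVisits₀ p'.1 p'.2 (N + 1) + topVisits₀ T p'.1 p'.2 (N + 1)) *
          pot T P (rowAt p' (N + 1)) (parAt p' (N + 1)) (vertAt p' N)) := by ring

/-- `potSum N ≤ ρ^N · potSum 0`. [cite: MadrasSlade1993, §1.2 (elementary counting)] -/
theorem potSum_le_pow_mul (hT : 2 ≤ T) (hV : PotValid T y ρ P) (N : ℕ) : potSum T y P N ≤ ρ ^ N * potSum T y P 0 := by
  induction N with
  | zero => simp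
  | succ N ih =>
    have hρ : 0 ≤ ρ := by linarith [hV.two_le]
    calc potSum T y P (N + 1) ≤ ρ * potSum T y P N := potSum_succ_le hT hV N
      _ ≤ ρ * (ρ ^ N * potSum T y P 0) := mul_le_mul_of_nonneg_left ih hρ
      _ = ρ ^ (N + 1) * potSum T y P 0 := by ring

/-- `C_{T,N+1}(y,y) ≤ potSum N / potMin`. [cite: BeatonBousquetMelouDeGierDuminilCopinGuttmann2014, §3.2 (arXiv v5 p. 10: C_{T,k}(y,z))] -/
theorem stripZ₂_le_potSum_div (hV : PotValid T y ρ P) (N : ℕ) : stripZ₂ T (N + 1) y y ≤ potSum T y P N / potMin P := by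
  have hm := potMin_pos hV
  rw [le_div_iff₀ hm, stripZ₂, potSum, Finset.sum_mul]
  refine Finset.sum_le_sum fun p _ => ?_
  rw [← pow_add]
  exact mul_le_mul_of_nonneg_left (potMin_le_pot hV (rowAt p (N + 1)) (parAt p (N + 1)) (vertAt p N)) (pow_nonneg hV.pos_y.le _)

/-- **The sub-geometric bound**: `C_{T,n}(y,y) ≤ C · ρ^n` for `n ≥ 1`, with `C = potSum 0/(potMin·ρ) + 1`.
[cite: BeatonBousquetMelouDeGierDuminilCopinGuttmann2014, §3.2 Proposition 6 (arXiv v5 p. 10); MadrasSlade1993, §1.2] -/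
theorem stripZ₂_le_const_mul_pow (hT : 2 ≤ T) (hV : PotValid T y ρ P) (N : ℕ) :
    stripZ₂ T (N + 1) y y ≤ (potSum T y P 0 / (potMin P * ρ) + 1) * ρ ^ (N + 1) := by
  have hm := potMin_pos hV
  have hρ : 0 < ρ := by linarith [hV.two_le]
  have h0 := potSum_nonneg hV 0
  calc stripZ₂ T (N + 1) y y ≤ potSum T y P N / potMin P := stripZ₂_le_potSum_div hV N
    _ ≤ ρ ^ N * potSum T y P 0 / potMin P := div_le_div_of_nonneg_right (potSum_le_pow_mul hT hV N) hm.le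
    _ = potSum T y P 0 / (potMin P * ρ) * ρ ^ (N + 1) := by field_simp; ring
    _ ≤ (potSum T y P 0 / (potMin P * ρ) + 1) * ρ ^ (N + 1) := by nlinarith [pow_pos hρ (N + 1)]

/-- **`μ_T(y,y) ≤ ρ`** whenever the wall potential is sub-harmonic at rate `ρ` (`T ≥ 2`). [cite: BeatonBousquetMelouDeGierDuminilCopinGuttmann2014, §3.2 Proposition 6 (arXiv v5 p. 10: μ_T(y,z) = lim C_{T,k}(y,z)^{1/k}); MadrasSlade1993, §8.2 (8.2.2)–(8.2.3)] -/
theorem stripMuY₂_self_le_of_potValid (hT : 2 ≤ T) (hV : PotValid T y ρ P) : stripMuY₂ T y y ≤ ρ := by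
  have hy0 := hV.pos_y
  have hρ : 0 < ρ := by linarith [hV.two_le]
  set C : ℝ := potSum T y P 0 / (potMin P * ρ) + 1 with hC
  have hC0 : 0 < C := by
    rw [hC]; have := div_nonneg (potSum_nonneg hV 0) (mul_pos (potMin_pos hV) hρ).le; linarith
  have hL := tendsto_stripZ₂_rpow T hy0 hy0
  have hR : Tendsto (fun n : ℕ => C ^ (1 / (n : ℝ)) * ρ) atTop (𝓝 (1 * ρ)) :=
    (tendsto_const_rpow_one_div_nat₀ hC0).mul_const ρ
  rw [one_mul] at hR
  refine le_of_tendsto_of_tendsto' hL hR fun n => ?_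
  rcases Nat.eq_zero_or_pos n with rfl | hn
  · simp only [Nat.cast_zero, div_zero, Real.rpow_zero, one_mul]
    linarith [hV.two_le]
  obtain ⟨N, rfl⟩ := Nat.exists_eq_succ_of_ne_zero hn.ne'
  have hZ0 : 0 ≤ stripZ₂ T (N + 1) y y := (stripZ₂_pos T _ hy0 hy0).le
  have hb := stripZ₂_le_const_mul_pow hT hV N
  have e : C ^ (1 / ((N + 1 : ℕ) : ℝ)) * ρ = (C * ρ ^ (N + 1)) ^ (1 / ((N + 1 : ℕ) : ℝ)) := by
    rw [Real.mul_rpow hC0.le (pow_nonneg hρ.le _), one_div, Real.pow_rpow_inv_natCast hρ.le (Nat.succ_ne_zero N)]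
  rw [Nat.succ_eq_add_one, e]
  exact Real.rpow_le_rpow hZ0 hb (by positivity)

/-! ### §4 Two explicit potentials: every width `T ≥ 2` at rate `√(y + 4/(√y−1))`, every width `T ≥ 3` at rate `√(y + 6/y)` -/

/-- The potential for all widths `T ≥ 2` (tight on the width-two switch blocks of length `5`).
[cite: MadrasSlade1993, §1.2 (elementary counting)] -/
def potValsA (y ρ : ℝ) : PotVals where
  a := (y + 4 * y / (ρ ^ 2 * (ρ - 1))) / ρ
  b := 2 * y / ρ
  c := 2 * y / (ρ * (ρ - 1))
  d := 4 * y / (ρ ^ 2 * (ρ - 1))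
  e := 2 * y / (ρ * (ρ - 1))
  f := 4 * y / (ρ ^ 2 * (ρ - 1))
  g := 4 * y / (ρ ^ 2 * (ρ - 1))
  k := 8 * y / (ρ ^ 3 * (ρ - 1))

/-- `potValsA` is sub-harmonic at rate `ρ` in EVERY `S_T` as soon as `ρ ≥ 2` and `y + 4y/(ρ²(ρ−1)) ≤ ρ²`.
[cite: MadrasSlade1993, §1.2 (elementary counting)] -/
theorem potValid_A (T : ℕ) (hy : 0 < y) (hρ : 2 ≤ ρ) (h : y + 4 * y / (ρ ^ 2 * (ρ - 1)) ≤ ρ ^ 2) :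
    PotValid T y ρ (potValsA y ρ) := by
  have hρ0 : 0 < ρ := by linarith
  have hρ1 : 0 < ρ - 1 := by linarith
  have hu : 0 < ρ * (ρ - 1) := mul_pos hρ0 hρ1
  have hu2 : 0 < ρ ^ 2 * (ρ - 1) := by positivity
  have hu3 : 0 < ρ ^ 3 * (ρ - 1) := by positivity
  have hc0 : 0 < 2 * y / (ρ * (ρ - 1)) := div_pos (by linarith) hu
  -- the recurring identities
  have e1 : ρ * (2 * y / (ρ * (ρ - 1))) = 2 * y / ρ + 2 * y / (ρ * (ρ - 1)) := by field_simp; ring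
  have e2 : ρ * (4 * y / (ρ ^ 2 * (ρ - 1))) = 2 * (2 * y / (ρ * (ρ - 1))) := by field_simp; ring
  have e3 : ρ * (8 * y / (ρ ^ 3 * (ρ - 1))) = 2 * (4 * y / (ρ ^ 2 * (ρ - 1))) := by field_simp; ring
  have h0 : 0 ≤ y * (ρ * (ρ - 1)) * (ρ - 2) := mul_nonneg (mul_nonneg hy.le hu.le) (by linarith)
  have i1 : 4 * y / (ρ ^ 2 * (ρ - 1)) ≤ 2 * y / (ρ * (ρ - 1)) := by
    rw [div_le_div_iff₀ hu2 hu]; linarith [h0]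
  have h0' : 0 ≤ y * (ρ ^ 2 * (ρ - 1)) * (ρ - 2) * ρ := by positivity
  have i2 : 8 * y / (ρ ^ 3 * (ρ - 1)) ≤ 4 * y / (ρ ^ 2 * (ρ - 1)) := by
    rw [div_le_div_iff₀ hu3 hu2]; nlinarith [h0', h0]
  refine ⟨hy, ?_, ?_, hc0, ?_, hc0, ?_, ?_, ?_, hρ, ?_, ?_, ?_, ?_, ?_, ?_, ?_, ?_, ?_, ?_, ?_⟩ <;> simp only [potValsA]
  · positivity
  · positivity
  · positivity
  · positivity
  · positivity
  · positivity
  · rwa [div_le_iff₀ hρ0, ← sq]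
  · rw [mul_div_cancel₀ _ hρ0.ne']
  · rw [mul_div_cancel₀ _ hρ0.ne']
  · split_ifs <;> (rw [e1]; linarith)
  · split_ifs <;> (rw [e2])
  · rw [e1]; nlinarith
  · rw [e1]; nlinarith
  · rw [e2]
  · rw [e2]; nlinarith
  · rw [e2]; nlinarith
  · rw [e3]

/-- The potential for widths `T ≥ 3` (no block of length `5`; tight on the one-row excursions of length `6`).
[cite: MadrasSlade1993, §1.2 (elementary counting)] -/
def potValsB (y ρ : ℝ) : PotVals where
  a := (y + 4 * y * (ρ + 2) / (ρ ^ 2 * (ρ ^ 3 - ρ - 2))) / ρ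
  b := 2 * y / ρ
  c := 2 * y * ρ / (ρ ^ 3 - ρ - 2)
  d := 4 * y * (ρ + 2) / (ρ ^ 2 * (ρ ^ 3 - ρ - 2))
  e := 2 * y * (ρ + 2) / (ρ * (ρ ^ 3 - ρ - 2))
  f := 4 * y / (ρ ^ 3 - ρ - 2)
  g := 4 * y / (ρ ^ 3 - ρ - 2)
  k := 8 * y / (ρ * (ρ ^ 3 - ρ - 2))

/-- `potValsB` is sub-harmonic at rate `ρ` in every `S_T` with `T ≠ 2` as soon as `ρ ≥ 2` and `y + d ≤ ρ²`.
[cite: MadrasSlade1993, §1.2 (elementary counting)] -/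
theorem potValid_B (hT : T ≠ 2) (hy : 0 < y) (hρ : 2 ≤ ρ) (h : y + 4 * y * (ρ + 2) / (ρ ^ 2 * (ρ ^ 3 - ρ - 2)) ≤ ρ ^ 2) :
    PotValid T y ρ (potValsB y ρ) := by
  have hρ0 : 0 < ρ := by linarith
  have hD : 0 < ρ ^ 3 - ρ - 2 := by nlinarith
  have hD1 : 0 < ρ * (ρ ^ 3 - ρ - 2) := by positivity
  have hD2 : 0 < ρ ^ 2 * (ρ ^ 3 - ρ - 2) := by positivity
  have hDne : ρ ^ 3 - ρ - 2 ≠ 0 := hD.ne'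
  have hρne : ρ ≠ 0 := hρ0.ne'
  -- the recurring identities
  have e1 : ρ * (2 * y * ρ / (ρ ^ 3 - ρ - 2)) = 2 * y * (ρ + 2) / (ρ * (ρ ^ 3 - ρ - 2)) + 2 * y / ρ := by
    rw [mul_div_assoc', div_add_div _ _ hD1.ne' hρne, div_eq_div_iff hDne (mul_ne_zero hD1.ne' hρne)]
    ring
  have e2 : ρ * (4 * y * (ρ + 2) / (ρ ^ 2 * (ρ ^ 3 - ρ - 2))) = 2 * (2 * y * (ρ + 2) / (ρ * (ρ ^ 3 - ρ - 2))) := by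
    field_simp; ring
  have e3 : ρ * (2 * y * (ρ + 2) / (ρ * (ρ ^ 3 - ρ - 2))) = 2 * y * ρ / (ρ ^ 3 - ρ - 2) + 4 * y / (ρ ^ 3 - ρ - 2) := by
    field_simp; ring
  have e4 : ρ * (4 * y / (ρ ^ 3 - ρ - 2)) = 2 * (2 * y * ρ / (ρ ^ 3 - ρ - 2)) := by field_simp; ring
  have e5 : ρ * (8 * y / (ρ * (ρ ^ 3 - ρ - 2))) = 2 * (4 * y / (ρ ^ 3 - ρ - 2)) := by field_simp; ring
  have h0 : 0 ≤ y * (ρ ^ 3 - ρ - 2) * (ρ - 2) * (ρ ^ 3 - ρ - 2) := by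
    have : 0 ≤ ρ - 2 := by linarith
    positivity
  have i1 : 8 * y / (ρ * (ρ ^ 3 - ρ - 2)) ≤ 4 * y / (ρ ^ 3 - ρ - 2) := by
    rw [div_le_div_iff₀ hD1 hD]; nlinarith [h0]
  have hg0 : 0 < 4 * y / (ρ ^ 3 - ρ - 2) := div_pos (by linarith) hD
  refine ⟨hy, ?_, ?_, ?_, ?_, ?_, hg0, hg0, ?_, hρ, ?_, ?_, ?_, ?_, ?_, ?_, ?_, ?_, ?_, ?_, ?_⟩ <;> simp only [potValsB, hT, if_false]
  · positivity
  · positivity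
  · positivity
  · positivity
  · positivity
  · positivity
  · rwa [div_le_iff₀ hρ0, ← sq]
  · rw [mul_div_cancel₀ _ hρ0.ne']
  · rw [mul_div_cancel₀ _ hρ0.ne']
  · rw [e1]
  · rw [e2]
  · rw [e3]
  · rw [e3]; linarith
  · rw [e4]
  · rw [e4]; nlinarith
  · rw [e4]; nlinarith
  · rw [e5]

end WallPot

open WallPot

variable {T : ℕ} {y ρ : ℝ}

/-- **`μ_T(y,y) ≤ ρ` for every `T ≥ 2`** once `ρ ≥ 2` and `y + 4y/(ρ²(ρ−1)) ≤ ρ²`. [cite: BeatonBousquetMelouDeGierDuminilCopinGuttmann2014, §3.2 Proposition 6 (arXiv v5 p. 10: μ_T(y,z))] -/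
theorem stripMuY₂_self_le_of_le_sq (hT : 2 ≤ T) (hy : 0 < y) (hρ : 2 ≤ ρ) (h : y + 4 * y / (ρ ^ 2 * (ρ - 1)) ≤ ρ ^ 2) :
    stripMuY₂ T y y ≤ ρ :=
  stripMuY₂_self_le_of_potValid hT (potValid_A T hy hρ h)

/-- **THE UNIFORM WINDOW, all widths `T ≥ 2`, `y ≥ 4`: `μ_T(y,y)² ≤ y + 4/(√y − 1)`** — together with the tree's `√y < μ_T(y,y)`
(`sqrt_lt_stripMuY₂_self`): `y < μ_T(y,y)² ≤ y + 4/(√y−1)`, uniformly in `T`. [cite: BeatonBousquetMelouDeGierDuminilCopinGuttmann2014, §3.2 Proposition 6 (arXiv v5 p. 10) and §3.1 Proposition 5 (p. 9 l. 16: μ(y) ≥ √y; p. 10 ll. 2–3: "μ(y) ∼ √y")] -/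
theorem stripMuY₂_self_sq_le_of_two_le (hT : 2 ≤ T) (hy : 4 ≤ y) :
    stripMuY₂ T y y ^ 2 ≤ y + 4 / (Real.sqrt y - 1) := by
  have hy0 : 0 < y := by linarith
  have hs2 : 2 ≤ Real.sqrt y := by
    rw [show (2:ℝ) = Real.sqrt 4 by rw [show (4:ℝ) = 2 ^ 2 by norm_num, Real.sqrt_sq (by norm_num)]]
    exact Real.sqrt_le_sqrt hy
  have hs1 : 0 < Real.sqrt y - 1 := by linarith
  have hsy : Real.sqrt y ^ 2 = y := Real.sq_sqrt hy0.le
  set ρ : ℝ := Real.sqrt (y + 4 / (Real.sqrt y - 1)) with hρdef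
  have hadd : 0 ≤ y + 4 / (Real.sqrt y - 1) := by have := div_pos (by norm_num : (0:ℝ) < 4) hs1; linarith
  have hρsq : ρ ^ 2 = y + 4 / (Real.sqrt y - 1) := Real.sq_sqrt hadd
  have hρs : Real.sqrt y ≤ ρ := Real.sqrt_le_sqrt (by linarith [div_pos (by norm_num : (0:ℝ) < 4) hs1])
  have hρ2 : 2 ≤ ρ := hs2.trans hρs
  have hρ0 : 0 < ρ := by linarith
  have hρy : y ≤ ρ ^ 2 := by rw [← hsy]; exact pow_le_pow_left₀ (by linarith) hρs 2
  have hcond : y + 4 * y / (ρ ^ 2 * (ρ - 1)) ≤ ρ ^ 2 := by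
    have h1 : 4 * y / (ρ ^ 2 * (ρ - 1)) ≤ 4 / (ρ - 1) := by
      rw [div_le_div_iff₀ (mul_pos (pow_pos hρ0 2) (by linarith)) (by linarith)]
      nlinarith
    have h2 : 4 / (ρ - 1) ≤ 4 / (Real.sqrt y - 1) :=
      div_le_div_of_nonneg_left (by norm_num) hs1 (by linarith)
    linarith
  have hμ := stripMuY₂_self_le_of_le_sq hT hy0 hρ2 hcond
  have hμ0 : 0 ≤ stripMuY₂ T y y := (stripMuY₂_pos T hy0 hy0).le
  rw [← hρsq]
  exact pow_le_pow_left₀ hμ0 hμ 2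

/-- **`μ_T(y,y) ≤ ρ` for every `T ≥ 3`** once `ρ ≥ 2` and `y + 4y(ρ+2)/(ρ²(ρ³−ρ−2)) ≤ ρ²`. [cite: BeatonBousquetMelouDeGierDuminilCopinGuttmann2014, §3.2 Proposition 6 (arXiv v5 p. 10: μ_T(y,z))] -/
theorem stripMuY₂_self_le_of_le_sq' (hT : 3 ≤ T) (hy : 0 < y) (hρ : 2 ≤ ρ)
    (h : y + 4 * y * (ρ + 2) / (ρ ^ 2 * (ρ ^ 3 - ρ - 2)) ≤ ρ ^ 2) : stripMuY₂ T y y ≤ ρ :=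
  stripMuY₂_self_le_of_potValid (by omega) (potValid_B (by omega) hy hρ h)

/-- **THE UNIFORM WINDOW, all widths `T ≥ 3`, `y ≥ 25`: `μ_T(y,y)² ≤ y + 6/y`.** [cite: BeatonBousquetMelouDeGierDuminilCopinGuttmann2014, §3.2 Proposition 6 (arXiv v5 p. 10) and §3.1 Proposition 5 (p. 10 ll. 2–3: "μ(y) ∼ √y")] -/
theorem stripMuY₂_self_sq_le_of_three_le (hT : 3 ≤ T) (hy : 25 ≤ y) : stripMuY₂ T y y ^ 2 ≤ y + 6 / y := by
  have hy0 : 0 < y := by linarith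
  have hs5 : 5 ≤ Real.sqrt y := by
    rw [show (5:ℝ) = Real.sqrt 25 by rw [show (25:ℝ) = 5 ^ 2 by norm_num, Real.sqrt_sq (by norm_num)]]
    exact Real.sqrt_le_sqrt hy
  have hsy : Real.sqrt y ^ 2 = y := Real.sq_sqrt hy0.le
  set ρ : ℝ := Real.sqrt (y + 6 / y) with hρdef
  have hadd : 0 ≤ y + 6 / y := by positivity
  have hρsq : ρ ^ 2 = y + 6 / y := Real.sq_sqrt hadd
  have hρs : Real.sqrt y ≤ ρ := Real.sqrt_le_sqrt (by linarith [div_pos (by norm_num : (0:ℝ) < 6) hy0])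
  have hρ5 : 5 ≤ ρ := hs5.trans hρs
  have hρ2 : 2 ≤ ρ := by linarith
  have hρy : y ≤ ρ ^ 2 := by rw [← hsy]; exact pow_le_pow_left₀ (by linarith) hρs 2
  have hD : 0 < ρ ^ 3 - ρ - 2 := by nlinarith
  have hcond : y + 4 * y * (ρ + 2) / (ρ ^ 2 * (ρ ^ 3 - ρ - 2)) ≤ ρ ^ 2 := by
    -- `4y(ρ+2)/(ρ²(ρ³−ρ−2)) ≤ 28/(5ρ²−7) ≤ 28/(5y − 7) ≤ 6/y`
    have h1 : 4 * y * (ρ + 2) / (ρ ^ 2 * (ρ ^ 3 - ρ - 2)) ≤ 6 / y := by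
      rw [div_le_div_iff₀ (by positivity) hy0]
      -- 4 y² (ρ+2) ≤ 6 ρ² (ρ³ − ρ − 2), using y ≤ ρ² and ρ ≥ 5
      have hρ3 : ρ + 2 ≤ (7/5) * ρ := by linarith
      nlinarith [mul_le_mul_of_nonneg_left hρy (by positivity : (0:ℝ) ≤ 4 * y * (ρ + 2)),
        mul_le_mul_of_nonneg_left hρy (by positivity : (0:ℝ) ≤ ρ ^ 2), pow_pos (by linarith : (0:ℝ) < ρ) 2,
        pow_pos (by linarith : (0:ℝ) < ρ) 3]
    linarith
  have hμ := stripMuY₂_self_le_of_le_sq' hT hy0 hρ2 hcond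
  have hμ0 : 0 ≤ stripMuY₂ T y y := (stripMuY₂_pos T hy0 hy0).le
  rw [← hρsq]
  exact pow_le_pow_left₀ hμ0 hμ 2

/-! ### §5 The order of the tower at high fugacity: width one on top (`y ≥ 25`), width two second (`y ≥ 400`) -/

/-- `(1 + x)^n ≤ exp(n·x)` for `x ≥ 0`. [folklore] -/
private theorem one_add_pow_le_exp_mul {x : ℝ} (hx : 0 ≤ x) (n : ℕ) : (1 + x) ^ n ≤ Real.exp (n * x) := by
  calc (1 + x) ^ n ≤ (Real.exp x) ^ n := pow_le_pow_left₀ (by linarith) (by linarith [Real.add_one_le_exp x]) n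
    _ = Real.exp (n * x) := (Real.exp_nat_mul x n).symm

/-- The width-one arithmetic: `(y + 4/(√y−1))^{2m+1} < m²·y^{2m}` with `m = ⌊2√y⌋ + 1`, `y ≥ 25`.
[cite: MadrasSlade1993, §1.2 (elementary real analysis)] -/
theorem windowA_pow_lt (hy : 25 ≤ y) :
    (y + 4 / (Real.sqrt y - 1)) ^ (2 * (⌊2 * Real.sqrt y⌋₊ + 1) + 1) <
      ((⌊2 * Real.sqrt y⌋₊ + 1 : ℕ) : ℝ) ^ 2 * y ^ (2 * (⌊2 * Real.sqrt y⌋₊ + 1)) := by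
  set m : ℕ := ⌊2 * Real.sqrt y⌋₊ + 1 with hm
  have hy0 : 0 < y := by linarith
  have hs5 : 5 ≤ Real.sqrt y := by
    rw [show (5:ℝ) = Real.sqrt 25 by rw [show (25:ℝ) = 5 ^ 2 by norm_num, Real.sqrt_sq (by norm_num)]]
    exact Real.sqrt_le_sqrt hy
  have hsy : Real.sqrt y ^ 2 = y := Real.sq_sqrt hy0.le
  have hs0 : 0 < Real.sqrt y := by linarith
  have hm_gt : 2 * Real.sqrt y < m := by rw [hm]; push_cast; exact Nat.lt_floor_add_one _
  have hm_le : (m : ℝ) ≤ 2 * Real.sqrt y + 1 := by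
    rw [hm]; push_cast; linarith [Nat.floor_le (by positivity : 0 ≤ 2 * Real.sqrt y)]
  -- `x = 4/(y(√y−1))`, `(2m+1)·x ≤ 1`
  set x : ℝ := 4 / (y * (Real.sqrt y - 1)) with hx
  have hs1 : 0 < Real.sqrt y - 1 := by linarith
  have hx0 : 0 ≤ x := by rw [hx]; positivity
  have hw : y + 4 / (Real.sqrt y - 1) = y * (1 + x) := by rw [hx]; field_simp
  have hnx : ((2 * m + 1 : ℕ) : ℝ) * x ≤ 1 := by
    push_cast
    rw [hx, mul_div_assoc', div_le_one (by positivity)]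
    -- (2m+1)·4 ≤ (4√y+3)·4 ≤ y(√y−1): with s = √y ≥ 5, y = s²: 16 s + 12 ≤ s²(s−1)
    have h1 : (2 * (m : ℝ) + 1) * 4 ≤ (4 * Real.sqrt y + 3) * 4 := by nlinarith
    have key : y * (Real.sqrt y - 1) - (16 * Real.sqrt y + 12) = (Real.sqrt y - 5) * (Real.sqrt y + 2) ^ 2 + 8 := by
      linear_combination (1 - Real.sqrt y) * hsy
    nlinarith [key, h1, mul_nonneg (sub_nonneg.2 hs5) (sq_nonneg (Real.sqrt y + 2))]
  have hexp : (1 + x) ^ (2 * m + 1) < 3 := by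
    calc (1 + x) ^ (2 * m + 1) ≤ Real.exp (((2 * m + 1 : ℕ) : ℝ) * x) := one_add_pow_le_exp_mul hx0 _
      _ ≤ Real.exp 1 := Real.exp_le_exp.2 hnx
      _ < 3 := by have := Real.exp_one_lt_d9; norm_num at this ⊢; linarith
  have hm2 : 4 * y < (m : ℝ) ^ 2 := by
    rw [← hsy]; nlinarith [hm_gt, hs0]
  calc (y + 4 / (Real.sqrt y - 1)) ^ (2 * m + 1) = y ^ (2 * m + 1) * (1 + x) ^ (2 * m + 1) := by rw [hw, mul_pow]
    _ < y ^ (2 * m + 1) * 3 := mul_lt_mul_of_pos_left hexp (by positivity)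
    _ = 3 * y * y ^ (2 * m) := by ring
    _ < (m : ℝ) ^ 2 * y ^ (2 * m) := mul_lt_mul_of_pos_right (by linarith) (by positivity)

/-- ★ **THE NARROWEST SLIT WINS at every width: `μ_T(y,y) < μ_1(y,y)` for all `T ≥ 2` and all `y ≥ 25`.** The two-wall tower
`T ↦ μ_T(y,y)` has its maximum at `T = 1`, uniformly: `μ_T(y,y)² ≤ y + 4/(√y−1) < ` the width-one switch bound `(m·y^m)^{2/(2m+1)}`,
`m = ⌊2√y⌋ + 1` (`mul_pow_le_stripMuY₂_one_self_pow`). [cite: BeatonBousquetMelouDeGierDuminilCopinGuttmann2014, §3.2 Proposition 6 (arXiv v5 p. 10: μ_T(y,z)) and §3.1 Proposition 5 (pp. 9–10: √y ≤ μ(y) ∼ √y)] -/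
theorem stripMuY₂_self_lt_one (hT : 2 ≤ T) (hy : 25 ≤ y) : stripMuY₂ T y y < stripMuY₂ 1 y y := by
  have hy0 : 0 < y := by linarith
  have hy1 : 1 ≤ y := by linarith
  set m : ℕ := ⌊2 * Real.sqrt y⌋₊ + 1 with hm
  have hm1 : 1 ≤ m := by omega
  have hμT := (stripMuY₂_pos T hy0 hy0).le
  have hμ1 := (stripMuY₂_pos 1 hy0 hy0).le
  have hA := stripMuY₂_self_sq_le_of_two_le hT (by linarith : (4:ℝ) ≤ y)
  have hB := mul_pow_le_stripMuY₂_one_self_pow hy1 hm1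
  have hW := windowA_pow_lt hy
  rw [← hm] at hW
  have hc0 : (0 : ℝ) ≤ (m : ℝ) * y ^ (m : ℕ) := by positivity
  have key : stripMuY₂ T y y ^ (2 * (2 * m + 1)) < stripMuY₂ 1 y y ^ (2 * (2 * m + 1)) := by
    calc stripMuY₂ T y y ^ (2 * (2 * m + 1)) = (stripMuY₂ T y y ^ 2) ^ (2 * m + 1) := pow_mul _ _ _
      _ ≤ (y + 4 / (Real.sqrt y - 1)) ^ (2 * m + 1) := pow_le_pow_left₀ (by positivity) hA _
      _ < (m : ℝ) ^ 2 * y ^ (2 * m) := hW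
      _ = ((m : ℝ) * y ^ (m : ℕ)) ^ 2 := by ring
      _ ≤ (stripMuY₂ 1 y y ^ (2 * m + 1)) ^ 2 := pow_le_pow_left₀ hc0 hB 2
      _ = stripMuY₂ 1 y y ^ (2 * (2 * m + 1)) := by rw [← pow_mul, mul_comm]
  exact lt_of_pow_lt_pow_left₀ _ hμ1 key

/-- **The width-one slit maximises the two-wall tower**: `μ_T(y,y) ≤ μ_1(y,y)` for every `T ≥ 1`, `y ≥ 25`.
[cite: BeatonBousquetMelouDeGierDuminilCopinGuttmann2014, §3.2 Proposition 6 (arXiv v5 p. 10: μ_T(y,z))] -/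
theorem stripMuY₂_self_le_one (hT : 1 ≤ T) (hy : 25 ≤ y) : stripMuY₂ T y y ≤ stripMuY₂ 1 y y := by
  rcases Nat.lt_or_ge T 2 with h | h
  · have : T = 1 := by omega
    rw [this]
  · exact (stripMuY₂_self_lt_one h hy).le

/-- The width-two arithmetic: `(y + 6/y)^{2m+3} < m²·y^{2m}` with `m = ⌊3y√y⌋ + 1`, `y ≥ 400`.
[cite: MadrasSlade1993, §1.2 (elementary real analysis)] -/
theorem windowB_pow_lt (hy : 400 ≤ y) :
    (y + 6 / y) ^ (2 * (⌊3 * y * Real.sqrt y⌋₊ + 1) + 3) <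
      ((⌊3 * y * Real.sqrt y⌋₊ + 1 : ℕ) : ℝ) ^ 2 * y ^ (2 * (⌊3 * y * Real.sqrt y⌋₊ + 1)) := by
  set m : ℕ := ⌊3 * y * Real.sqrt y⌋₊ + 1 with hm
  have hy0 : 0 < y := by linarith
  have hs20 : 20 ≤ Real.sqrt y := by
    rw [show (20:ℝ) = Real.sqrt 400 by rw [show (400:ℝ) = 20 ^ 2 by norm_num, Real.sqrt_sq (by norm_num)]]
    exact Real.sqrt_le_sqrt hy
  have hsy : Real.sqrt y ^ 2 = y := Real.sq_sqrt hy0.le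
  have hs0 : 0 < Real.sqrt y := by linarith
  have hm_gt : 3 * y * Real.sqrt y < m := by rw [hm]; push_cast; exact Nat.lt_floor_add_one _
  have hm_le : (m : ℝ) ≤ 3 * y * Real.sqrt y + 1 := by
    rw [hm]; push_cast; linarith [Nat.floor_le (by positivity : 0 ≤ 3 * y * Real.sqrt y)]
  set x : ℝ := 6 / y ^ 2 with hx
  have hx0 : 0 ≤ x := by rw [hx]; positivity
  have hw : y + 6 / y = y * (1 + x) := by rw [hx]; field_simp
  have hnx : ((2 * m + 3 : ℕ) : ℝ) * x ≤ 2 := by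
    push_cast
    rw [hx, mul_div_assoc', div_le_iff₀ (by positivity)]
    -- (2m+3)·6 ≤ (6y√y + 5)·6 ≤ 2y²: with s = √y ≥ 20, y = s²
    have h1 : (2 * (m : ℝ) + 3) * 6 ≤ (6 * y * Real.sqrt y + 5) * 6 := by nlinarith
    have k1 : y * y = y * Real.sqrt y ^ 2 := by rw [hsy]
    have k2 : 0 ≤ y * Real.sqrt y * (Real.sqrt y - 20) := mul_nonneg (mul_nonneg hy0.le hs0.le) (sub_nonneg.2 hs20)
    nlinarith [k1, k2, h1]
  have hexp : (1 + x) ^ (2 * m + 3) < 9 := by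
    calc (1 + x) ^ (2 * m + 3) ≤ Real.exp (((2 * m + 3 : ℕ) : ℝ) * x) := one_add_pow_le_exp_mul hx0 _
      _ ≤ Real.exp 2 := Real.exp_le_exp.2 hnx
      _ = Real.exp 1 ^ 2 := by rw [← Real.exp_nat_mul]; norm_num
      _ < 9 := by
          have h := Real.exp_one_lt_d9
          have h0 := (Real.exp_pos 1).le
          nlinarith
  have hm2 : 9 * y ^ 3 < (m : ℝ) ^ 2 := by
    have : (3 * y * Real.sqrt y) ^ 2 = 9 * y ^ 3 := by rw [mul_pow, mul_pow, hsy]; ring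
    rw [← this]
    exact pow_lt_pow_left₀ hm_gt (by positivity) two_ne_zero
  calc (y + 6 / y) ^ (2 * m + 3) = y ^ (2 * m + 3) * (1 + x) ^ (2 * m + 3) := by rw [hw, mul_pow]
    _ < y ^ (2 * m + 3) * 9 := mul_lt_mul_of_pos_left hexp (by positivity)
    _ = 9 * y ^ 3 * y ^ (2 * m) := by ring
    _ < (m : ℝ) ^ 2 * y ^ (2 * m) := mul_lt_mul_of_pos_right hm2 (by positivity)

/-- ★ **WIDTH TWO IS SECOND: `μ_T(y,y) < μ_2(y,y)` for all `T ≥ 3` and all `y ≥ 400`** (`μ_T(y,y)² ≤ y + 6/y <` the width-two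
switch bound `(m·y^m)^{2/(2m+3)}`, `m = ⌊3y√y⌋ + 1`, `mul_pow_le_stripMuY₂_self_pow`). [cite: BeatonBousquetMelouDeGierDuminilCopinGuttmann2014, §3.2 Proposition 6 (arXiv v5 p. 10: μ_T(y,z)) and §3.1 Proposition 5 (pp. 9–10: √y ≤ μ(y) ∼ √y)] -/
theorem stripMuY₂_self_lt_two (hT : 3 ≤ T) (hy : 400 ≤ y) : stripMuY₂ T y y < stripMuY₂ 2 y y := by
  have hy0 : 0 < y := by linarith
  have hy1 : 1 ≤ y := by linarith
  set m : ℕ := ⌊3 * y * Real.sqrt y⌋₊ + 1 with hm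
  have hm1 : 1 ≤ m := by omega
  have hμT := (stripMuY₂_pos T hy0 hy0).le
  have hμ2 := (stripMuY₂_pos 2 hy0 hy0).le
  have hA := stripMuY₂_self_sq_le_of_three_le hT (by linarith : (25:ℝ) ≤ y)
  have hB := mul_pow_le_stripMuY₂_self_pow (T := 2) (by norm_num) hy1 hm1
  rw [show 2 * m + 2 * 2 - 1 = 2 * m + 3 by omega] at hB
  have hW := windowB_pow_lt hy
  rw [← hm] at hW
  have hc0 : (0 : ℝ) ≤ (m : ℝ) * y ^ (m : ℕ) := by positivity
  have key : stripMuY₂ T y y ^ (2 * (2 * m + 3)) < stripMuY₂ 2 y y ^ (2 * (2 * m + 3)) := by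
    calc stripMuY₂ T y y ^ (2 * (2 * m + 3)) = (stripMuY₂ T y y ^ 2) ^ (2 * m + 3) := pow_mul _ _ _
      _ ≤ (y + 6 / y) ^ (2 * m + 3) := pow_le_pow_left₀ (by positivity) hA _
      _ < (m : ℝ) ^ 2 * y ^ (2 * m) := hW
      _ = ((m : ℝ) * y ^ (m : ℕ)) ^ 2 := by ring
      _ ≤ (stripMuY₂ 2 y y ^ (2 * m + 3)) ^ 2 := pow_le_pow_left₀ hc0 hB 2
      _ = stripMuY₂ 2 y y ^ (2 * (2 * m + 3)) := by rw [← pow_mul, mul_comm]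
  exact lt_of_pow_lt_pow_left₀ _ hμ2 key

/-- **The width-two slit maximises the tower from `T = 2` on**: `μ_T(y,y) ≤ μ_2(y,y)` for every `T ≥ 2`, `y ≥ 400`.
[cite: BeatonBousquetMelouDeGierDuminilCopinGuttmann2014, §3.2 Proposition 6 (arXiv v5 p. 10: μ_T(y,z))] -/
theorem stripMuY₂_self_le_two (hT : 2 ≤ T) (hy : 400 ≤ y) : stripMuY₂ T y y ≤ stripMuY₂ 2 y y := by
  rcases Nat.lt_or_ge T 3 with h | h
  · have : T = 2 := by omega
    rw [this]
  · exact (stripMuY₂_self_lt_two h hy).le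

/-- **The top of the tower at `y ≥ 400`: `μ_1(y,y) > μ_2(y,y) > μ_T(y,y)` for every `T ≥ 3`.**
[cite: BeatonBousquetMelouDeGierDuminilCopinGuttmann2014, §3.2 Proposition 6 (arXiv v5 p. 10: μ_T(y,z))] -/
theorem stripMuY₂_self_chain (hT : 3 ≤ T) (hy : 400 ≤ y) :
    stripMuY₂ T y y < stripMuY₂ 2 y y ∧ stripMuY₂ 2 y y < stripMuY₂ 1 y y :=
  ⟨stripMuY₂_self_lt_two hT hy, stripMuY₂_self_lt_one le_rfl (by linarith)⟩

end Literature.Probability.RandomPlanarGeometry.SAW.HexBW
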